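import Literature.NumberTheory.DiophantineGeometry.TateAlgorithm
import Literature.NumberTheory.DiophantineGeometry.TateAlgorithmRootCount
import HarnessLib

/-!
# Tate's algorithm in residue characteristic `≠ 2, 3`: local analysis over a DVR

Correctness of steps 1–11 of Tate's algorithm (Silverman ATAEC IV.9.4) as implemented by
`WeierstrassCurve.kodairaSymbolOfMinimal` in
`Literature.NumberTheory.DiophantineGeometry.TateAlgorithm`, over a discrete valuation ring `R` in
which `2` and `3` are units, in the following form (`addVal_Δ_toNat_eq_numComponents_add_one`):
if `W` is a Weierstrass equation over `R` with `Δ ≠ 0`, `Δ ∈ 𝔪`, `c₄ ∈ 𝔪` (additive reduction)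
and such that no change of variables `(1, r, s, t)` over `R` makes `π ^ i ∣ aᵢ` for all `i`
(which holds when `W` is a minimal equation), then
`ord (Δ) = m + 1` where `m` is the number of components of the Kodaira type computed by the
algorithm, i.e. `ord Δ = 2, 3, 4, 6, 6 + n, 8, 9, 10` for types `II, III, IV, I₀*, Iₙ*, IV*, III*,
II*` (Silverman ATAEC IV, Table 4.1, rows `m` and `v(Δ)`, and step 7: "if `p ≠ 2` then
`n = v(Δ) − 6`").

## Strategy

Every normalising change of variables chosen by the algorithm has `u = 1`, so `Δ`, `c₄`, `c₆`
are the same for all intermediate models; all information passed between steps is expressed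
through divisibility of `c₄, c₆, Δ`. For each step we parametrise the normalised model
(`aᵢ = π ^ k · xᵢ`), factor `4 Δ = π ^ e · (main term + π · rest)` by `ring`, and show that the
step's test succeeds iff the main term is a unit. The normalising translations exist because
`2, 3 ∈ Rˣ`: completing the square and the cube gives a model `(0, 0, 0, −c₄/48, −c₆/864)`
(`exists_variableChange_shortForm`), and the root translations of step 7 exist by
`Literature.NumberTheory.DiophantineGeometry.TateAlgorithm.exists_double_root_of_cubicDiscr_eq_zero`.

## References

* J. H. Silverman, *Advanced Topics in the Arithmetic of Elliptic Curves*, GTM 151, 1994, IV.9.4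
  and Table 4.1 (p. 365).
* J. Tate, *Algorithm for determining the type of a singular fiber in an elliptic pencil*,
  LNM 476, 1975.
-/

open Polynomial IsLocalRing
open IsDiscreteValuationRing hiding maximalIdeal

namespace Literature.NumberTheory.DiophantineGeometry

namespace TateAlgorithm

/-! ### Divisibility by powers of a uniformiser in a DVR -/

section OrdAPI

variable {R : Type*} [CommRing R] [IsDomain R] [IsDiscreteValuationRing R]

/-- `x ∈ 𝔪 ^ n ↔ ϖ ^ n ∣ x` for a uniformiser `ϖ`. [folklore] -/
theorem mem_maximalIdeal_pow_iff_dvd_of_irreducible {ϖ : R} (hϖ : Irreducible ϖ) (x : R) (n : ℕ) :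
    x ∈ maximalIdeal R ^ n ↔ ϖ ^ n ∣ x := by
  rw [hϖ.maximalIdeal_eq, Ideal.span_singleton_pow, Ideal.mem_span_singleton]

/-- `x ∈ 𝔪 ↔ ϖ ∣ x` for a uniformiser `ϖ`. [folklore] -/
theorem mem_maximalIdeal_iff_dvd_of_irreducible {ϖ : R} (hϖ : Irreducible ϖ) (x : R) :
    x ∈ maximalIdeal R ↔ ϖ ∣ x := by
  rw [hϖ.maximalIdeal_eq, Ideal.mem_span_singleton]

/-- `x` is a non-unit iff `ϖ ∣ x`. [folklore] -/
theorem not_isUnit_iff_dvd {ϖ : R} (hϖ : Irreducible ϖ) (x : R) : ¬ IsUnit x ↔ ϖ ∣ x := by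
  rw [← mem_maximalIdeal_iff_dvd_of_irreducible hϖ, mem_maximalIdeal, mem_nonunits_iff]

/-- `x` is a unit iff `ϖ ∤ x`. [folklore] -/
theorem isUnit_iff_not_dvd {ϖ : R} (hϖ : Irreducible ϖ) (x : R) : IsUnit x ↔ ¬ ϖ ∣ x := by
  rw [← not_isUnit_iff_dvd hϖ, not_not]

/-- The residue of a multiple of `ϖ` vanishes. [folklore] -/
theorem residue_eq_zero_of_dvd {ϖ : R} (hϖ : Irreducible ϖ) {x : R} (h : ϖ ∣ x) :
    residue R x = 0 :=
  (residue_eq_zero_iff x).mpr ((mem_maximalIdeal_iff_dvd_of_irreducible hϖ x).mpr h)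

/-- The residue of a uniformiser vanishes. [folklore] -/
theorem residue_uniformizer_eq_zero {ϖ : R} (hϖ : Irreducible ϖ) : residue R ϖ = 0 :=
  residue_eq_zero_of_dvd hϖ dvd_rfl

/-- `x` is a unit iff its residue is nonzero (restated). [folklore] -/
theorem isUnit_iff_residue_ne_zero (x : R) : IsUnit x ↔ residue R x ≠ 0 :=
  (residue_ne_zero_iff_isUnit x).symm

/-- `ϖ ∣ x` iff the residue of `x` vanishes. [folklore] -/
theorem dvd_iff_residue_eq_zero {ϖ : R} (hϖ : Irreducible ϖ) (x : R) :
    ϖ ∣ x ↔ residue R x = 0 := by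
  rw [residue_eq_zero_iff, mem_maximalIdeal_iff_dvd_of_irreducible hϖ]

/-- If `c x = ϖ ^ n u` with `c, u` units then `ord x = n`. [folklore] -/
theorem addVal_toNat_eq_of_eq {ϖ : R} (hϖ : Irreducible ϖ) {c x u : R} {n : ℕ} (hc : IsUnit c)
    (hu : IsUnit u) (h : c * x = ϖ ^ n * u) : (addVal R x).toNat = n := by
  have h1 : addVal R (c * x) = addVal R x := by
    rw [addVal_mul, addVal_eq_zero_iff.mpr hc, zero_add]
  have h2 : addVal R (c * x) = n := by
    rw [h, mul_comm]
    exact addVal_def _ hu.unit hϖ n rfl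
  rw [← h1, h2]
  rfl

/-- `ϖ ^ n ∣ x ↔ n ≤ ord x`. [folklore] -/
theorem pow_dvd_iff_le_addVal_of_irreducible {ϖ : R} (hϖ : Irreducible ϖ) (x : R) (n : ℕ) :
    ϖ ^ n ∣ x ↔ (n : ℕ∞) ≤ addVal R x := by
  rw [← addVal_le_iff_dvd, addVal_pow, addVal_uniformizer hϖ, nsmul_one]

/-- If `ϖ ^ (2k+1) ∣ x²` then `ϖ ^ (k+1) ∣ x`. [folklore] -/
theorem pow_succ_dvd_of_pow_dvd_sq {ϖ : R} (hϖ : Irreducible ϖ) {x : R} {k : ℕ}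
    (h : ϖ ^ (2 * k + 1) ∣ x ^ 2) : ϖ ^ (k + 1) ∣ x := by
  rw [pow_dvd_iff_le_addVal_of_irreducible hϖ] at h ⊢
  rw [addVal_pow, nsmul_eq_mul] at h
  generalize addVal R x = v at h ⊢
  induction v using ENat.recTopCoe with
  | top => exact le_top
  | coe m =>
    norm_cast at h
    exact_mod_cast (show k + 1 ≤ m by omega)

/-- If `ϖ ^ (2k) ∣ x²` then `ϖ ^ k ∣ x`. [folklore] -/
theorem pow_dvd_of_pow_dvd_sq {ϖ : R} (hϖ : Irreducible ϖ) {x : R} {k : ℕ}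
    (h : ϖ ^ (2 * k) ∣ x ^ 2) : ϖ ^ k ∣ x := by
  rw [pow_dvd_iff_le_addVal_of_irreducible hϖ] at h ⊢
  rw [addVal_pow, nsmul_eq_mul] at h
  generalize addVal R x = v at h ⊢
  induction v using ENat.recTopCoe with
  | top => exact le_top
  | coe m =>
    norm_cast at h
    exact_mod_cast (show k ≤ m by omega)

/-- A unit plus a multiple of `ϖ` is a unit. [folklore] -/
theorem isUnit_add_mul_of_isUnit {ϖ : R} (hϖ : Irreducible ϖ) {x : R} (hx : IsUnit x) (y : R) :
    IsUnit (x + ϖ * y) := by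
  rw [isUnit_iff_residue_ne_zero] at hx ⊢
  rwa [map_add, map_mul, residue_uniformizer_eq_zero hϖ, zero_mul, add_zero]

/-- If `c x = ϖ ^ n (u + ϖ y)` with `c, u` units then `ord x = n`. [folklore] -/
theorem addVal_toNat_eq_of_eq_add {ϖ : R} (hϖ : Irreducible ϖ) {c x u y : R} {n : ℕ}
    (hc : IsUnit c) (hu : IsUnit u) (h : c * x = ϖ ^ n * (u + ϖ * y)) :
    (addVal R x).toNat = n :=
  addVal_toNat_eq_of_eq hϖ hc (isUnit_add_mul_of_isUnit hϖ hu y) h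

/-- If `ϖ ^ k ∣ x ≠ 0` then `k ≤ ord x`. [folklore] -/
theorem le_addVal_toNat_of_pow_dvd {ϖ : R} (hϖ : Irreducible ϖ) {x : R} (hx : x ≠ 0) {k : ℕ}
    (h : ϖ ^ k ∣ x) : k ≤ (addVal R x).toNat := by
  rw [pow_dvd_iff_le_addVal_of_irreducible hϖ] at h
  have hne : addVal R x ≠ ⊤ := by rwa [Ne, addVal_eq_top_iff]
  generalize addVal R x = v at h hne ⊢
  induction v using ENat.recTopCoe with
  | top => exact (hne rfl).elim
  | coe m => exact_mod_cast h

omit [IsDomain R] [IsDiscreteValuationRing R] in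
/-- Units among small numerals when `2, 3 ∈ Rˣ`. [folklore] -/
theorem isUnit_four (h2 : IsUnit (2 : R)) : IsUnit (4 : R) := by
  simpa [show (2 : R) * 2 = 4 by norm_num] using h2.mul h2

omit [IsDomain R] [IsDiscreteValuationRing R] in
/-- Units among small numerals when `2, 3 ∈ Rˣ`. [folklore] -/
theorem isUnit_32 (h2 : IsUnit (2 : R)) : IsUnit (32 : R) := by
  simpa [show (2 : R) ^ 5 = 32 by norm_num] using h2.pow 5

omit [IsDomain R] [IsDiscreteValuationRing R] in
/-- Units among small numerals when `2, 3 ∈ Rˣ`. [folklore] -/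
theorem isUnit_48 (h2 : IsUnit (2 : R)) (h3 : IsUnit (3 : R)) : IsUnit (48 : R) := by
  simpa [show (2 : R) ^ 4 * 3 = 48 by norm_num] using (h2.pow 4).mul h3

omit [IsDomain R] [IsDiscreteValuationRing R] in
/-- Units among small numerals when `2, 3 ∈ Rˣ`. [folklore] -/
theorem isUnit_108 (h2 : IsUnit (2 : R)) (h3 : IsUnit (3 : R)) : IsUnit (108 : R) := by
  simpa [show (2 : R) ^ 2 * 3 ^ 3 = 108 by norm_num] using (h2.pow 2).mul (h3.pow 3)

omit [IsDomain R] [IsDiscreteValuationRing R] in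
/-- Units among small numerals when `2, 3 ∈ Rˣ`. [folklore] -/
theorem isUnit_864 (h2 : IsUnit (2 : R)) (h3 : IsUnit (3 : R)) : IsUnit (864 : R) := by
  simpa [show (2 : R) ^ 5 * 3 ^ 3 = 864 by norm_num] using (h2.pow 5).mul (h3.pow 3)

/-- The residue field of `R` has `3 ≠ 0` when `3 ∈ Rˣ`. [folklore] -/
theorem residue_three_ne_zero (h3 : IsUnit (3 : R)) : (3 : ResidueField R) ≠ 0 := by
  have := (isUnit_iff_residue_ne_zero (3 : R)).mp h3
  rwa [map_ofNat] at this

/-- `divPow (ϖ ^ j x) j = x` for the chosen uniformiser `ϖ = uniformizer R`. [folklore] -/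
theorem divPow_uniformizer_pow_mul (x : R) (j : ℕ) :
    divPow (uniformizer R ^ j * x) j = x := by
  classical
  unfold divPow
  have h : uniformizer R ^ j ∣ uniformizer R ^ j * x := dvd_mul_right _ _
  rw [dif_pos h]
  exact (mul_left_cancel₀ (pow_ne_zero _ irreducible_uniformizer.ne_zero) h.choose_spec).symm

/-- `redCoeff (ϖ ^ j x) j = x̄` for `ϖ = uniformizer R`. [folklore] -/
theorem redCoeff_uniformizer_pow_mul (x : R) (j : ℕ) :
    redCoeff (uniformizer R ^ j * x) j = residue R x := by
  rw [redCoeff, divPow_uniformizer_pow_mul]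

/-- `redCoeff (ϖ x) 1 = x̄` for `ϖ = uniformizer R`. [folklore] -/
theorem redCoeff_uniformizer_mul (x : R) :
    redCoeff (uniformizer R * x) 1 = residue R x := by
  rw [← redCoeff_uniformizer_pow_mul x 1, pow_one]

/-- The residue field of `R` has `2 ≠ 0` when `2 ∈ Rˣ`. [folklore] -/
theorem residue_two_ne_zero (h2 : IsUnit (2 : R)) : (2 : ResidueField R) ≠ 0 := by
  have := (isUnit_iff_residue_ne_zero (2 : R)).mp h2
  rwa [map_ofNat] at this

end OrdAPI

/-! ### Distinct-root counts of the auxiliary polynomials -/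

section RootCounts

variable {R : Type*} [CommRing R] [IsDomain R] [IsDiscreteValuationRing R]

/-- Step 6 test: three distinct roots iff the cubic discriminant is nonzero. [folklore] -/
theorem distinctRootCount_cubic_eq_three_iff (p q r : ResidueField R) :
    distinctRootCount (X ^ 3 + C p * X ^ 2 + C q * X + C r) = 3 ↔
      p ^ 2 * q ^ 2 - 4 * q ^ 3 - 4 * p ^ 3 * r - 27 * r ^ 2 + 18 * p * q * r ≠ 0 := by
  unfold distinctRootCount
  convert card_aroots_toFinset_cubic_eq_three_iff (L := AlgebraicClosure (ResidueField R)) p q r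

/-- Step 7 test: given vanishing discriminant, two distinct roots iff `p² ≠ 3q`. [folklore] -/
theorem distinctRootCount_cubic_eq_two_iff (p q r : ResidueField R)
    (hdisc : p ^ 2 * q ^ 2 - 4 * q ^ 3 - 4 * p ^ 3 * r - 27 * r ^ 2 + 18 * p * q * r = 0) :
    distinctRootCount (X ^ 3 + C p * X ^ 2 + C q * X + C r) = 2 ↔ p ^ 2 - 3 * q ≠ 0 := by
  unfold distinctRootCount
  convert card_aroots_toFinset_cubic_eq_two_iff (L := AlgebraicClosure (ResidueField R)) p q r
    hdisc

/-- Steps 7–8 test: the monic quadratic `Y² + a Y − c` has distinct roots iff `a² + 4c ≠ 0`.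
[folklore] -/
theorem distinctRootCount_monicQuadratic_eq_two_iff (h2 : IsUnit (2 : R)) (a c : ResidueField R) :
    distinctRootCount (X ^ 2 + C a * X - C c) = 2 ↔ a ^ 2 + 4 * c ≠ 0 := by
  unfold distinctRootCount
  convert card_aroots_toFinset_monicQuadratic_eq_two_iff (L := AlgebraicClosure (ResidueField R))
    a c (residue_two_ne_zero h2)

/-- Step 7 test: the quadratic `a X² + b X + c` (`a ≠ 0`) has distinct roots iff `b² − 4ac ≠ 0`.
[folklore] -/
theorem distinctRootCount_quadratic_eq_two_iff (h2 : IsUnit (2 : R)) {a : ResidueField R}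
    (ha : a ≠ 0) (b c : ResidueField R) :
    distinctRootCount (C a * X ^ 2 + C b * X + C c) = 2 ↔ b ^ 2 - 4 * a * c ≠ 0 := by
  unfold distinctRootCount
  convert card_aroots_toFinset_quadratic_eq_two_iff (L := AlgebraicClosure (ResidueField R))
    (b := b) (c := c) ha (residue_two_ne_zero h2)

end RootCounts

/-! ### Changes of variables with `u = 1`; the short Weierstrass form -/

section ShortForm

variable {R : Type*} [CommRing R]

/-- For `u = 1` the invariants `c₄, c₆, Δ` are unchanged. [folklore] -/
theorem c₄_smul_of_u_eq_one {C : WeierstrassCurve.VariableChange R} (hu : C.u = 1)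
    (W : WeierstrassCurve R) : (C • W).c₄ = W.c₄ := by
  rw [WeierstrassCurve.variableChange_c₄, hu, inv_one, Units.val_one, one_pow, one_mul]

/-- For `u = 1` the invariant `c₆` is unchanged. [folklore] -/
theorem c₆_smul_of_u_eq_one {C : WeierstrassCurve.VariableChange R} (hu : C.u = 1)
    (W : WeierstrassCurve R) : (C • W).c₆ = W.c₆ := by
  rw [WeierstrassCurve.variableChange_c₆, hu, inv_one, Units.val_one, one_pow, one_mul]

/-- For `u = 1` the discriminant is unchanged. [folklore] -/
theorem Δ_smul_of_u_eq_one {C : WeierstrassCurve.VariableChange R} (hu : C.u = 1)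
    (W : WeierstrassCurve R) : (C • W).Δ = W.Δ := by
  rw [WeierstrassCurve.variableChange_Δ, hu, inv_one, Units.val_one, one_pow, one_mul]

/-- Coefficients of `(1, r, s, t) • W`. [folklore] -/
theorem smul_a₁_of_u_eq_one {C : WeierstrassCurve.VariableChange R} (hu : C.u = 1)
    (W : WeierstrassCurve R) : (C • W).a₁ = W.a₁ + 2 * C.s := by
  rw [WeierstrassCurve.variableChange_a₁, hu, inv_one, Units.val_one, one_mul]

/-- Coefficients of `(1, r, s, t) • W`. [folklore] -/
theorem smul_a₂_of_u_eq_one {C : WeierstrassCurve.VariableChange R} (hu : C.u = 1)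
    (W : WeierstrassCurve R) : (C • W).a₂ = W.a₂ - C.s * W.a₁ + 3 * C.r - C.s ^ 2 := by
  rw [WeierstrassCurve.variableChange_a₂, hu, inv_one, Units.val_one, one_pow, one_mul]

/-- Coefficients of `(1, r, s, t) • W`. [folklore] -/
theorem smul_a₃_of_u_eq_one {C : WeierstrassCurve.VariableChange R} (hu : C.u = 1)
    (W : WeierstrassCurve R) : (C • W).a₃ = W.a₃ + C.r * W.a₁ + 2 * C.t := by
  rw [WeierstrassCurve.variableChange_a₃, hu, inv_one, Units.val_one, one_pow, one_mul]

/-- Coefficients of `(1, r, s, t) • W`. [folklore] -/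
theorem smul_a₄_of_u_eq_one {C : WeierstrassCurve.VariableChange R} (hu : C.u = 1)
    (W : WeierstrassCurve R) : (C • W).a₄ = W.a₄ - C.s * W.a₃ + 2 * C.r * W.a₂ -
      (C.t + C.r * C.s) * W.a₁ + 3 * C.r ^ 2 - 2 * C.s * C.t := by
  rw [WeierstrassCurve.variableChange_a₄, hu, inv_one, Units.val_one, one_pow, one_mul]

/-- Coefficients of `(1, r, s, t) • W`. [folklore] -/
theorem smul_a₆_of_u_eq_one {C : WeierstrassCurve.VariableChange R} (hu : C.u = 1)
    (W : WeierstrassCurve R) : (C • W).a₆ = W.a₆ + C.r * W.a₄ + C.r ^ 2 * W.a₂ + C.r ^ 3 -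
      C.t * W.a₃ - C.t ^ 2 - C.r * C.t * W.a₁ := by
  rw [WeierstrassCurve.variableChange_a₆, hu, inv_one, Units.val_one, one_pow, one_mul]

/-- **Short Weierstrass form** by a `u = 1` change of variables when `2, 3 ∈ Rˣ`: completing the
square (`s = −a₁/2`, `t = −(a₃ + r a₁)/2`) and the cube (`r = −(a₂ − s a₁ − s²)/3`) gives
`a₁ = a₂ = a₃ = 0`, and then `c₄ = −48 a₄`, `c₆ = −864 a₆` (Silverman AEC III.1). [folklore] -/
theorem exists_variableChange_shortForm (h2 : IsUnit (2 : R)) (h3 : IsUnit (3 : R))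
    (W : WeierstrassCurve R) :
    ∃ C : WeierstrassCurve.VariableChange R, C.u = 1 ∧ (C • W).a₁ = 0 ∧ (C • W).a₂ = 0 ∧
      (C • W).a₃ = 0 ∧ 48 * (C • W).a₄ = -W.c₄ ∧ 864 * (C • W).a₆ = -W.c₆ := by
  obtain ⟨i2, hi2⟩ := h2.exists_right_inv
  obtain ⟨i3, hi3⟩ := h3.exists_right_inv
  set s : R := -W.a₁ * i2 with hs
  set r : R := -(W.a₂ - s * W.a₁ - s ^ 2) * i3 with hr
  set t : R := -(W.a₃ + r * W.a₁) * i2 with ht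
  let C : WeierstrassCurve.VariableChange R := ⟨1, r, s, t⟩
  have hu : C.u = 1 := rfl
  have h₁ : (C • W).a₁ = 0 := by
    rw [smul_a₁_of_u_eq_one hu]
    change W.a₁ + 2 * s = 0
    rw [hs]; linear_combination (-W.a₁) * hi2
  have h₂ : (C • W).a₂ = 0 := by
    rw [smul_a₂_of_u_eq_one hu]
    change W.a₂ - s * W.a₁ + 3 * r - s ^ 2 = 0
    rw [hr]; linear_combination (-(W.a₂ - s * W.a₁ - s ^ 2)) * hi3
  have h₃ : (C • W).a₃ = 0 := by
    rw [smul_a₃_of_u_eq_one hu]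
    change W.a₃ + r * W.a₁ + 2 * t = 0
    rw [ht]; linear_combination (-(W.a₃ + r * W.a₁)) * hi2
  refine ⟨C, hu, h₁, h₂, h₃, ?_, ?_⟩
  · rw [← c₄_smul_of_u_eq_one hu W]
    simp only [WeierstrassCurve.c₄, WeierstrassCurve.b₂, WeierstrassCurve.b₄, h₁, h₂, h₃]
    ring
  · rw [← c₆_smul_of_u_eq_one hu W]
    simp only [WeierstrassCurve.c₆, WeierstrassCurve.b₂, WeierstrassCurve.b₄,
      WeierstrassCurve.b₆, h₁, h₂, h₃]
    ring

/-- `4 Δ` expressed through `b₂, b₄, b₆` only (using `4 b₈ = b₂ b₆ − b₄²`). [folklore] -/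
theorem four_mul_Δ_eq (W : WeierstrassCurve R) :
    4 * W.Δ = -W.b₂ ^ 2 * (W.b₂ * W.b₆ - W.b₄ ^ 2) - 32 * W.b₄ ^ 3 - 108 * W.b₆ ^ 2 +
      36 * W.b₂ * W.b₄ * W.b₆ := by
  simp only [WeierstrassCurve.Δ]
  linear_combination (-W.b₂ ^ 2) * W.b_relation

end ShortForm

/-! ### Factorisations of `4 Δ`, `c₄`, `c₆` on normalised models -/

section StepIdentities

variable {R : Type*} [CommRing R] (W : WeierstrassCurve R) (ϖ : R)

/-- Steps 3–5 model: `b₄, b₆` from `a₃ = ϖγ, a₄ = ϖq, a₆ = ϖr`. [folklore] -/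
theorem b₄_of_a {γ q : R} (ha₃ : W.a₃ = ϖ * γ) (ha₄ : W.a₄ = ϖ * q) :
    W.b₄ = ϖ * (2 * q + W.a₁ * γ) := by
  simp only [WeierstrassCurve.b₄]; rw [ha₃, ha₄]; ring

/-- Steps 3–5 model: `b₆` from `a₃ = ϖγ, a₆ = ϖr`. [folklore] -/
theorem b₆_of_a {γ r : R} (ha₃ : W.a₃ = ϖ * γ) (ha₆ : W.a₆ = ϖ * r) :
    W.b₆ = ϖ * (4 * r + ϖ * γ ^ 2) := by
  simp only [WeierstrassCurve.b₆]; rw [ha₃, ha₆]; ring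

/-- Step 3: `4Δ = ϖ² (−108 B₆² + ϖ J)`. [folklore] -/
theorem four_Δ_step3 {β B₄ B₆ : R} (hb₂ : W.b₂ = ϖ * β) (hb₄ : W.b₄ = ϖ * B₄)
    (hb₆ : W.b₆ = ϖ * B₆) :
    4 * W.Δ = ϖ ^ 2 * (-108 * B₆ ^ 2 +
      ϖ * (-32 * B₄ ^ 3 + 36 * β * B₄ * B₆ - ϖ * β ^ 2 * (β * B₆ - B₄ ^ 2))) := by
  rw [four_mul_Δ_eq, hb₂, hb₄, hb₆]; ring

/-- Step 4: `4 b₈ = ϖ² (ϖ β B₆ − B₄²)`. [folklore] -/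
theorem four_b₈_step4 {β B₄ B₆ : R} (hb₂ : W.b₂ = ϖ * β) (hb₄ : W.b₄ = ϖ * B₄)
    (hb₆ : W.b₆ = ϖ ^ 2 * B₆) :
    4 * W.b₈ = ϖ ^ 2 * (ϖ * β * B₆ - B₄ ^ 2) := by
  rw [W.b_relation, hb₂, hb₄, hb₆]; ring

/-- Step 4: `4Δ = ϖ³ (−32 B₄³ + ϖ J)`. [folklore] -/
theorem four_Δ_step4 {β B₄ B₆ : R} (hb₂ : W.b₂ = ϖ * β) (hb₄ : W.b₄ = ϖ * B₄)
    (hb₆ : W.b₆ = ϖ ^ 2 * B₆) :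
    4 * W.Δ = ϖ ^ 3 * (-32 * B₄ ^ 3 +
      ϖ * (-β ^ 2 * (ϖ * β * B₆ - B₄ ^ 2) - 108 * B₆ ^ 2 + 36 * β * B₄ * B₆)) := by
  rw [four_mul_Δ_eq, hb₂, hb₄, hb₆]; ring

/-- Step 5: `4Δ = ϖ⁴ (−108 B₆² + ϖ J)`. [folklore] -/
theorem four_Δ_step5 {β B₄ B₆ : R} (hb₂ : W.b₂ = ϖ * β) (hb₄ : W.b₄ = ϖ ^ 2 * B₄)
    (hb₆ : W.b₆ = ϖ ^ 2 * B₆) :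
    4 * W.Δ = ϖ ^ 4 * (-108 * B₆ ^ 2 +
      ϖ * (-β ^ 2 * (β * B₆ - ϖ * B₄ ^ 2) - 32 * ϖ * B₄ ^ 3 + 36 * β * B₄ * B₆)) := by
  rw [four_mul_Δ_eq, hb₂, hb₄, hb₆]; ring

/-- `c₄ = ϖ² (β² − 24 B₄)` when `b₂ = ϖβ`, `b₄ = ϖ² B₄`. [folklore] -/
theorem c₄_of_b {β B₄ : R} (hb₂ : W.b₂ = ϖ * β) (hb₄ : W.b₄ = ϖ ^ 2 * B₄) :
    W.c₄ = ϖ ^ 2 * (β ^ 2 - 24 * B₄) := by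
  simp only [WeierstrassCurve.c₄]; rw [hb₂, hb₄]; ring

/-- `c₆ = ϖ³ (−β³ + 36 β B₄ − 216 B₆)` when `b₂ = ϖβ`, `b₄ = ϖ² B₄`, `b₆ = ϖ³ B₆`. [folklore] -/
theorem c₆_of_b {β B₄ B₆ : R} (hb₂ : W.b₂ = ϖ * β) (hb₄ : W.b₄ = ϖ ^ 2 * B₄)
    (hb₆ : W.b₆ = ϖ ^ 3 * B₆) :
    W.c₆ = ϖ ^ 3 * (-β ^ 3 + 36 * β * B₄ - 216 * B₆) := by
  simp only [WeierstrassCurve.c₆]; rw [hb₂, hb₄, hb₆]; ring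

/-- Step 6 model (`aᵢ = ϖα, ϖp, ϖ²γ, ϖ²q, ϖ³r`): `b₂`. [folklore] -/
theorem b₂_step6 {α p : R} (ha₁ : W.a₁ = ϖ * α) (ha₂ : W.a₂ = ϖ * p) :
    W.b₂ = ϖ * (4 * p + ϖ * α ^ 2) := by
  simp only [WeierstrassCurve.b₂]; rw [ha₁, ha₂]; ring

/-- Step 6 model: `b₄`. [folklore] -/
theorem b₄_step6 {α γ q : R} (ha₁ : W.a₁ = ϖ * α) (ha₃ : W.a₃ = ϖ ^ 2 * γ)
    (ha₄ : W.a₄ = ϖ ^ 2 * q) : W.b₄ = ϖ ^ 2 * (2 * q + ϖ * α * γ) := by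
  simp only [WeierstrassCurve.b₄]; rw [ha₁, ha₃, ha₄]; ring

/-- Step 6 model: `b₆`. [folklore] -/
theorem b₆_step6 {γ r : R} (ha₃ : W.a₃ = ϖ ^ 2 * γ) (ha₆ : W.a₆ = ϖ ^ 3 * r) :
    W.b₆ = ϖ ^ 3 * (4 * r + ϖ * γ ^ 2) := by
  simp only [WeierstrassCurve.b₆]; rw [ha₃, ha₆]; ring

/-- Step 6: `4Δ = ϖ⁶ D`. [folklore] -/
theorem four_Δ_step6 {B₂ B₄ B₆ : R} (hb₂ : W.b₂ = ϖ * B₂) (hb₄ : W.b₄ = ϖ ^ 2 * B₄)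
    (hb₆ : W.b₆ = ϖ ^ 3 * B₆) :
    4 * W.Δ = ϖ ^ 6 *
      (-B₂ ^ 2 * (B₂ * B₆ - B₄ ^ 2) - 32 * B₄ ^ 3 - 108 * B₆ ^ 2 + 36 * B₂ * B₄ * B₆) := by
  rw [four_mul_Δ_eq, hb₂, hb₄, hb₆]; ring

/-- Step 8 model (`ϖα, ϖ²p, ϖ²γ, ϖ³q, ϖ⁴r`): `b₂`. [folklore] -/
theorem b₂_step8 {α p : R} (ha₁ : W.a₁ = ϖ * α) (ha₂ : W.a₂ = ϖ ^ 2 * p) :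
    W.b₂ = ϖ ^ 2 * (4 * p + α ^ 2) := by
  simp only [WeierstrassCurve.b₂]; rw [ha₁, ha₂]; ring

/-- Step 8 model: `b₄`. [folklore] -/
theorem b₄_step8 {α γ q : R} (ha₁ : W.a₁ = ϖ * α) (ha₃ : W.a₃ = ϖ ^ 2 * γ)
    (ha₄ : W.a₄ = ϖ ^ 3 * q) : W.b₄ = ϖ ^ 3 * (2 * q + α * γ) := by
  simp only [WeierstrassCurve.b₄]; rw [ha₁, ha₃, ha₄]; ring

/-- Step 8 model: `b₆`. [folklore] -/
theorem b₆_step8 {γ r : R} (ha₃ : W.a₃ = ϖ ^ 2 * γ) (ha₆ : W.a₆ = ϖ ^ 4 * r) :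
    W.b₆ = ϖ ^ 4 * (γ ^ 2 + 4 * r) := by
  simp only [WeierstrassCurve.b₆]; rw [ha₃, ha₆]; ring

/-- Step 8: `4Δ = ϖ⁸ (−108 B₆² + ϖ J)`. [folklore] -/
theorem four_Δ_step8 {B₂ B₄ B₆ : R} (hb₂ : W.b₂ = ϖ ^ 2 * B₂) (hb₄ : W.b₄ = ϖ ^ 3 * B₄)
    (hb₆ : W.b₆ = ϖ ^ 4 * B₆) :
    4 * W.Δ = ϖ ^ 8 * (-108 * B₆ ^ 2 +
      ϖ * (-32 * B₄ ^ 3 + 36 * B₂ * B₄ * B₆ - ϖ * B₂ ^ 2 * (B₂ * B₆ - B₄ ^ 2))) := by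
  rw [four_mul_Δ_eq, hb₂, hb₄, hb₆]; ring

/-- Step 8 → 9: `c₄` when `b₂ = ϖ² B₂`, `b₄ = ϖ³ B₄`. [folklore] -/
theorem c₄_step8 {B₂ B₄ : R} (hb₂ : W.b₂ = ϖ ^ 2 * B₂) (hb₄ : W.b₄ = ϖ ^ 3 * B₄) :
    W.c₄ = ϖ ^ 3 * (ϖ * B₂ ^ 2 - 24 * B₄) := by
  simp only [WeierstrassCurve.c₄]; rw [hb₂, hb₄]; ring

/-- Step 8 → 9: `c₆` when moreover `b₆ = ϖ⁵ B₆`. [folklore] -/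
theorem c₆_step8 {B₂ B₄ B₆ : R} (hb₂ : W.b₂ = ϖ ^ 2 * B₂) (hb₄ : W.b₄ = ϖ ^ 3 * B₄)
    (hb₆ : W.b₆ = ϖ ^ 5 * B₆) :
    W.c₆ = ϖ ^ 5 * (-ϖ * B₂ ^ 3 + 36 * B₂ * B₄ - 216 * B₆) := by
  simp only [WeierstrassCurve.c₆]; rw [hb₂, hb₄, hb₆]; ring

/-- Step 9 model (`ϖα, ϖ²p, ϖ³γ, ϖ³q, ϖ⁵r`): `b₄`. [folklore] -/
theorem b₄_step9 {α γ q : R} (ha₁ : W.a₁ = ϖ * α) (ha₃ : W.a₃ = ϖ ^ 3 * γ)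
    (ha₄ : W.a₄ = ϖ ^ 3 * q) : W.b₄ = ϖ ^ 3 * (2 * q + ϖ * α * γ) := by
  simp only [WeierstrassCurve.b₄]; rw [ha₁, ha₃, ha₄]; ring

/-- Step 9 model: `b₆`. [folklore] -/
theorem b₆_step9 {γ r : R} (ha₃ : W.a₃ = ϖ ^ 3 * γ) (ha₆ : W.a₆ = ϖ ^ 5 * r) :
    W.b₆ = ϖ ^ 5 * (4 * r + ϖ * γ ^ 2) := by
  simp only [WeierstrassCurve.b₆]; rw [ha₃, ha₆]; ring

/-- Step 9: `4Δ = ϖ⁹ (−32 B₄³ + ϖ J)`. [folklore] -/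
theorem four_Δ_step9 {B₂ B₄ B₆ : R} (hb₂ : W.b₂ = ϖ ^ 2 * B₂) (hb₄ : W.b₄ = ϖ ^ 3 * B₄)
    (hb₆ : W.b₆ = ϖ ^ 5 * B₆) :
    4 * W.Δ = ϖ ^ 9 * (-32 * B₄ ^ 3 +
      ϖ * (-B₂ ^ 2 * (ϖ * B₂ * B₆ - B₄ ^ 2) - 108 * B₆ ^ 2 + 36 * B₂ * B₄ * B₆)) := by
  rw [four_mul_Δ_eq, hb₂, hb₄, hb₆]; ring

/-- Step 10 model (`a₄ = ϖ⁴ q`): `b₄`. [folklore] -/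
theorem b₄_step10 {α γ q : R} (ha₁ : W.a₁ = ϖ * α) (ha₃ : W.a₃ = ϖ ^ 3 * γ)
    (ha₄ : W.a₄ = ϖ ^ 4 * q) : W.b₄ = ϖ ^ 4 * (2 * q + α * γ) := by
  simp only [WeierstrassCurve.b₄]; rw [ha₁, ha₃, ha₄]; ring

/-- Step 10: `4Δ = ϖ¹⁰ (−108 B₆² + ϖ J)`. [folklore] -/
theorem four_Δ_step10 {B₂ B₄ B₆ : R} (hb₂ : W.b₂ = ϖ ^ 2 * B₂) (hb₄ : W.b₄ = ϖ ^ 4 * B₄)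
    (hb₆ : W.b₆ = ϖ ^ 5 * B₆) :
    4 * W.Δ = ϖ ^ 10 * (-108 * B₆ ^ 2 +
      ϖ * (-B₂ ^ 2 * (B₂ * B₆ - ϖ * B₄ ^ 2) - 32 * ϖ * B₄ ^ 3 + 36 * B₂ * B₄ * B₆)) := by
  rw [four_mul_Δ_eq, hb₂, hb₄, hb₆]; ring

/-- `Iₙ*` round `m` model (`ϖα, ϖp, ϖ^{m+2}γ, ϖ^{m+3}q, ϖ^{2m+4}r`): `b₄`. [folklore] -/
theorem b₄_istar1 {m : ℕ} {α γ q : R} (ha₁ : W.a₁ = ϖ * α) (ha₃ : W.a₃ = ϖ ^ (m + 2) * γ)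
    (ha₄ : W.a₄ = ϖ ^ (m + 3) * q) : W.b₄ = ϖ ^ (m + 3) * (2 * q + α * γ) := by
  simp only [WeierstrassCurve.b₄]; rw [ha₁, ha₃, ha₄]; ring

/-- `Iₙ*` round `m` model: `b₆`. [folklore] -/
theorem b₆_istar1 {m : ℕ} {γ r : R} (ha₃ : W.a₃ = ϖ ^ (m + 2) * γ)
    (ha₆ : W.a₆ = ϖ ^ (2 * m + 4) * r) : W.b₆ = ϖ ^ (2 * m + 4) * (γ ^ 2 + 4 * r) := by
  simp only [WeierstrassCurve.b₆]; rw [ha₃, ha₆]; ring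

/-- `Iₙ*` round `m`, first test: `4Δ = ϖ^{2m+7} (−B₂³ B₆ + ϖ J)`. [folklore] -/
theorem four_Δ_istar1 {m : ℕ} {B₂ B₄ B₆ : R} (hb₂ : W.b₂ = ϖ * B₂)
    (hb₄ : W.b₄ = ϖ ^ (m + 3) * B₄) (hb₆ : W.b₆ = ϖ ^ (2 * m + 4) * B₆) :
    4 * W.Δ = ϖ ^ (2 * m + 7) * (-B₂ ^ 3 * B₆ + ϖ * (B₂ ^ 2 * B₄ ^ 2 -
      32 * ϖ ^ (m + 1) * B₄ ^ 3 - 108 * ϖ ^ (2 * m) * B₆ ^ 2 + 36 * ϖ ^ m * B₂ * B₄ * B₆)) := by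
  rw [four_mul_Δ_eq, hb₂, hb₄, hb₆]; ring

/-- `Iₙ*` rounds: `c₄ = ϖ² (B₂² − 24 ϖ^{m+1} B₄)`. [folklore] -/
theorem c₄_istar {m : ℕ} {B₂ B₄ : R} (hb₂ : W.b₂ = ϖ * B₂) (hb₄ : W.b₄ = ϖ ^ (m + 3) * B₄) :
    W.c₄ = ϖ ^ 2 * (B₂ ^ 2 - 24 * ϖ ^ (m + 1) * B₄) := by
  simp only [WeierstrassCurve.c₄]; rw [hb₂, hb₄]; ring

/-- `Iₙ*` round `m`, second model (`a₃ = ϖ^{m+3}γ, a₄ = ϖ^{m+3}q, a₆ = ϖ^{2m+5}r`): `b₄`.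
[folklore] -/
theorem b₄_istar2 {m : ℕ} {α γ q : R} (ha₁ : W.a₁ = ϖ * α) (ha₃ : W.a₃ = ϖ ^ (m + 3) * γ)
    (ha₄ : W.a₄ = ϖ ^ (m + 3) * q) : W.b₄ = ϖ ^ (m + 3) * (2 * q + ϖ * α * γ) := by
  simp only [WeierstrassCurve.b₄]; rw [ha₁, ha₃, ha₄]; ring

/-- `Iₙ*` round `m`, second model: `b₆`. [folklore] -/
theorem b₆_istar2 {m : ℕ} {γ r : R} (ha₃ : W.a₃ = ϖ ^ (m + 3) * γ)
    (ha₆ : W.a₆ = ϖ ^ (2 * m + 5) * r) : W.b₆ = ϖ ^ (2 * m + 5) * (4 * r + ϖ * γ ^ 2) := by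
  simp only [WeierstrassCurve.b₆]; rw [ha₃, ha₆]; ring

/-- `Iₙ*` round `m`, second test: `4Δ = ϖ^{2m+8} (−B₂² (B₂ B₆ − B₄²) + ϖ (ϖ^m J))`.
[folklore] -/
theorem four_Δ_istar2 {m : ℕ} {B₂ B₄ B₆ : R} (hb₂ : W.b₂ = ϖ * B₂)
    (hb₄ : W.b₄ = ϖ ^ (m + 3) * B₄) (hb₆ : W.b₆ = ϖ ^ (2 * m + 5) * B₆) :
    4 * W.Δ = ϖ ^ (2 * m + 8) * (-B₂ ^ 2 * (B₂ * B₆ - B₄ ^ 2) + ϖ * (ϖ ^ m *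
      (-32 * B₄ ^ 3 - 108 * ϖ ^ (m + 1) * B₆ ^ 2 + 36 * B₂ * B₄ * B₆))) := by
  rw [four_mul_Δ_eq, hb₂, hb₄, hb₆]; ring

end StepIdentities

/-! ### Existence of the normalising translations -/

section Existence

variable {R : Type*} [CommRing R] [IsDomain R] [IsDiscreteValuationRing R]

omit [IsDomain R] [IsDiscreteValuationRing R] in
/-- Short form with prescribed divisibility of `a₄, a₆` from that of `c₄, c₆` (`2, 3 ∈ Rˣ`).
This gives the translations of steps 2, 6, 8, 9 of Tate's algorithm in residue characteristic
`≠ 2, 3`. [folklore] -/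
theorem exists_variableChange_of_dvd_c₄_c₆ {ϖ : R} (h2 : IsUnit (2 : R)) (h3 : IsUnit (3 : R))
    (W : WeierstrassCurve R) {i j : ℕ} (hc₄ : ϖ ^ i ∣ W.c₄) (hc₆ : ϖ ^ j ∣ W.c₆) :
    ∃ C : WeierstrassCurve.VariableChange R, C.u = 1 ∧ (C • W).a₁ = 0 ∧ (C • W).a₂ = 0 ∧
      (C • W).a₃ = 0 ∧ ϖ ^ i ∣ (C • W).a₄ ∧ ϖ ^ j ∣ (C • W).a₆ := by
  obtain ⟨C, hu, h₁, h₂, h₃, h₄, h₆⟩ := exists_variableChange_shortForm h2 h3 W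
  refine ⟨C, hu, h₁, h₂, h₃, ?_, ?_⟩
  · rw [← (isUnit_48 h2 h3).dvd_mul_left, h₄]; exact (dvd_neg).mpr hc₄
  · rw [← (isUnit_864 h2 h3).dvd_mul_left, h₆]; exact (dvd_neg).mpr hc₆

/-- Step 7, initial translation "so that the double root of `P(T)` is `T = 0`": given a lift
`ρ` of a double root of the step-6 cubic, `x ↦ x + ϖρ` yields `π ∣ a₁, a₂`, `π² ∣ a₃`,
`π³ ∣ a₄`, `π⁴ ∣ a₆` (Silverman ATAEC IV.9.4, step 7). [folklore] -/
theorem exists_variableChange_istarInit {ϖ : R} (hϖ : Irreducible ϖ) (W : WeierstrassCurve R)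
    {α p γ q r ρ : R} (ha₁ : W.a₁ = ϖ * α) (ha₂ : W.a₂ = ϖ * p) (ha₃ : W.a₃ = ϖ ^ 2 * γ)
    (ha₄ : W.a₄ = ϖ ^ 2 * q) (ha₆ : W.a₆ = ϖ ^ 3 * r)
    (hP : ϖ ∣ ρ ^ 3 + p * ρ ^ 2 + q * ρ + r) (hP' : ϖ ∣ 3 * ρ ^ 2 + 2 * p * ρ + q) :
    ∃ C : WeierstrassCurve.VariableChange R, C.u = 1 ∧
      (C • W).a₁ ∈ maximalIdeal R ∧ (C • W).a₂ ∈ maximalIdeal R ∧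
      (C • W).a₃ ∈ maximalIdeal R ^ 2 ∧ (C • W).a₄ ∈ maximalIdeal R ^ 3 ∧
      (C • W).a₆ ∈ maximalIdeal R ^ 4 := by
  obtain ⟨w, hw⟩ := hP
  obtain ⟨w', hw'⟩ := hP'
  let C : WeierstrassCurve.VariableChange R := ⟨1, ϖ * ρ, 0, 0⟩
  have hu : C.u = 1 := rfl
  have hr : C.r = ϖ * ρ := rfl
  have hs : C.s = 0 := rfl
  have ht : C.t = 0 := rfl
  refine ⟨C, hu, ?_, ?_, ?_, ?_, ?_⟩
  · rw [mem_maximalIdeal_iff_dvd_of_irreducible hϖ, smul_a₁_of_u_eq_one hu, hs, ha₁]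
    exact ⟨α, by ring⟩
  · rw [mem_maximalIdeal_iff_dvd_of_irreducible hϖ, smul_a₂_of_u_eq_one hu, hs, hr, ha₁, ha₂]
    exact ⟨p + 3 * ρ, by ring⟩
  · rw [mem_maximalIdeal_pow_iff_dvd_of_irreducible hϖ, smul_a₃_of_u_eq_one hu, hr, ht, ha₁, ha₃]
    exact ⟨γ + ρ * α, by ring⟩
  · rw [mem_maximalIdeal_pow_iff_dvd_of_irreducible hϖ, smul_a₄_of_u_eq_one hu, hr, hs, ht, ha₁, ha₂, ha₃, ha₄]
    exact ⟨w', by linear_combination ϖ ^ 2 * hw'⟩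
  · rw [mem_maximalIdeal_pow_iff_dvd_of_irreducible hϖ, smul_a₆_of_u_eq_one hu, hr, ht, ha₁, ha₂, ha₃, ha₄, ha₆]
    exact ⟨w, by linear_combination ϖ ^ 3 * hw⟩

/-- Step 7, round `m`, translation "so that the double root of `Y² + a₃,ₘ₊₂ Y − a₆,₂ₘ₊₄` is
`Y = 0`": `y ↦ y − a₃/2` (Silverman ATAEC IV.9.4, step 7). [folklore] -/
theorem exists_variableChange_istarA {ϖ : R} (hϖ : Irreducible ϖ) (h2 : IsUnit (2 : R))
    (W : WeierstrassCurve R) {m : ℕ} {α p γ q r : R} (ha₁ : W.a₁ = ϖ * α) (ha₂ : W.a₂ = ϖ * p)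
    (ha₃ : W.a₃ = ϖ ^ (m + 2) * γ) (ha₄ : W.a₄ = ϖ ^ (m + 3) * q)
    (ha₆ : W.a₆ = ϖ ^ (2 * m + 4) * r) (h : ϖ ∣ γ ^ 2 + 4 * r) :
    ∃ C : WeierstrassCurve.VariableChange R, C.u = 1 ∧
      (C • W).a₁ ∈ maximalIdeal R ∧ (C • W).a₂ ∈ maximalIdeal R ∧
      (C • W).a₃ ∈ maximalIdeal R ^ (m + 3) ∧ (C • W).a₄ ∈ maximalIdeal R ^ (m + 3) ∧
      (C • W).a₆ ∈ maximalIdeal R ^ (2 * m + 5) := by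
  obtain ⟨i2, hi2⟩ := h2.exists_right_inv
  obtain ⟨w, hw⟩ := h
  let C : WeierstrassCurve.VariableChange R := ⟨1, 0, 0, -W.a₃ * i2⟩
  have hu : C.u = 1 := rfl
  have hr : C.r = 0 := rfl
  have hs : C.s = 0 := rfl
  have ht : C.t = -W.a₃ * i2 := rfl
  refine ⟨C, hu, ?_, ?_, ?_, ?_, ?_⟩
  · rw [mem_maximalIdeal_iff_dvd_of_irreducible hϖ, smul_a₁_of_u_eq_one hu, hs, ha₁]
    exact ⟨α, by ring⟩
  · rw [mem_maximalIdeal_iff_dvd_of_irreducible hϖ, smul_a₂_of_u_eq_one hu, hs, hr, ha₂]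
    exact ⟨p, by ring⟩
  · rw [mem_maximalIdeal_pow_iff_dvd_of_irreducible hϖ, smul_a₃_of_u_eq_one hu, hr, ht]
    exact ⟨0, by linear_combination (-W.a₃) * hi2⟩
  · rw [mem_maximalIdeal_pow_iff_dvd_of_irreducible hϖ, smul_a₄_of_u_eq_one hu, hr, hs, ht, ha₁, ha₃, ha₄]
    exact ⟨q + i2 * γ * α, by ring⟩
  · rw [mem_maximalIdeal_pow_iff_dvd_of_irreducible hϖ, smul_a₆_of_u_eq_one hu, hr, ht, ha₃, ha₆]
    have h4 : IsUnit (4 : R) := isUnit_four h2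
    -- 4 (r + (i2 - i2²) γ²) = γ² + 4 r = ϖ w
    have hX : ϖ ∣ r + (i2 - i2 ^ 2) * γ ^ 2 := by
      rw [← h4.dvd_mul_left]
      exact ⟨w, by linear_combination hw - γ ^ 2 * (2 * i2 - 1) * hi2⟩
    obtain ⟨X, hX⟩ := hX
    exact ⟨X, by linear_combination ϖ ^ (2 * m + 4) * hX⟩

/-- Step 7, round `m`, translation "so that the double root of `a₂,₁ X² + a₄,ₘ₊₃ X + a₆,₂ₘ₊₅`
is `X = 0`": `x ↦ x − ϖ^{m+2} q/(2p)` (Silverman ATAEC IV.9.4, step 7). [folklore] -/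
theorem exists_variableChange_istarB {ϖ : R} (hϖ : Irreducible ϖ) (h2 : IsUnit (2 : R))
    (W : WeierstrassCurve R) {m : ℕ} {α p γ q r : R} (hp : IsUnit p) (ha₁ : W.a₁ = ϖ * α)
    (ha₂ : W.a₂ = ϖ * p) (ha₃ : W.a₃ = ϖ ^ (m + 3) * γ) (ha₄ : W.a₄ = ϖ ^ (m + 3) * q)
    (ha₆ : W.a₆ = ϖ ^ (2 * m + 5) * r) (h : ϖ ∣ q ^ 2 - 4 * p * r) :
    ∃ C : WeierstrassCurve.VariableChange R, C.u = 1 ∧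
      (C • W).a₁ ∈ maximalIdeal R ∧ (C • W).a₂ ∈ maximalIdeal R ∧
      (C • W).a₃ ∈ maximalIdeal R ^ (m + 3) ∧ (C • W).a₄ ∈ maximalIdeal R ^ (m + 4) ∧
      (C • W).a₆ ∈ maximalIdeal R ^ (2 * m + 6) := by
  obtain ⟨ip, hip⟩ := (h2.mul hp).exists_right_inv
  obtain ⟨w, hw⟩ := h
  set ρ : R := -q * ip with hρ
  let C : WeierstrassCurve.VariableChange R := ⟨1, ϖ ^ (m + 2) * ρ, 0, 0⟩
  have hu : C.u = 1 := rfl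
  have hr : C.r = ϖ ^ (m + 2) * ρ := rfl
  have hs : C.s = 0 := rfl
  have ht : C.t = 0 := rfl
  refine ⟨C, hu, ?_, ?_, ?_, ?_, ?_⟩
  · rw [mem_maximalIdeal_iff_dvd_of_irreducible hϖ, smul_a₁_of_u_eq_one hu, hs, ha₁]
    exact ⟨α, by ring⟩
  · rw [mem_maximalIdeal_iff_dvd_of_irreducible hϖ, smul_a₂_of_u_eq_one hu, hs, hr, ha₁, ha₂]
    exact ⟨p + 3 * ϖ ^ (m + 1) * ρ, by ring⟩
  · rw [mem_maximalIdeal_pow_iff_dvd_of_irreducible hϖ, smul_a₃_of_u_eq_one hu, hr, ht, ha₁, ha₃]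
    exact ⟨γ + ρ * α, by ring⟩
  · rw [mem_maximalIdeal_pow_iff_dvd_of_irreducible hϖ, smul_a₄_of_u_eq_one hu, hr, hs, ht, ha₁, ha₂, ha₃, ha₄]
    exact ⟨3 * ϖ ^ m * ρ ^ 2, by
      rw [hρ]; linear_combination (-ϖ ^ (m + 3) * q) * hip⟩
  · rw [mem_maximalIdeal_pow_iff_dvd_of_irreducible hϖ, smul_a₆_of_u_eq_one hu, hr, ht, ha₁, ha₂, ha₃, ha₄, ha₆]
    have h4p : IsUnit (4 * p) := (isUnit_four h2).mul hp
    have hX : ϖ ∣ r + ρ * q + p * ρ ^ 2 := by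
      rw [← h4p.dvd_mul_left]
      refine ⟨-w, ?_⟩
      rw [hρ]
      linear_combination -hw + q ^ 2 * (2 * p * ip - 1) * hip
    obtain ⟨X, hX⟩ := hX
    exact ⟨X + ϖ ^ m * ρ ^ 3, by linear_combination ϖ ^ (2 * m + 5) * hX⟩

end Existence

/-! ### The tests of steps 3–10 versus `ord Δ` -/

section Phases

variable {R : Type*} [CommRing R] [IsDomain R] [IsDiscreteValuationRing R]

/-- **Steps 3–5** (Silverman ATAEC IV.9.4) on a model with `π ∣ a₃, a₄, a₆` and `π ∣ b₂`, in
residue characteristic `≠ 2, 3`: step 3 fires iff `ord Δ = 2` (type II), else step 4 fires iff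
`ord Δ = 3` (type III), else step 5 fires iff `ord Δ = 4` (type IV), else `π² ∣ c₄` and `π³ ∣ c₆`
(Table 4.1: `v(Δ) = 2, 3, 4`). [cite: SilvermanATAEC1994, IV.9.4 steps 3–5 and Table 4.1] -/
theorem steps345 {ϖ : R} (hϖ : Irreducible ϖ) (h2 : IsUnit (2 : R)) (h3 : IsUnit (3 : R))
    (W : WeierstrassCurve R) (ha₃ : ϖ ∣ W.a₃) (ha₄ : ϖ ∣ W.a₄) (ha₆ : ϖ ∣ W.a₆) (hb₂ : ϖ ∣ W.b₂) :
    (¬ ϖ ^ 2 ∣ W.a₆ → (addVal R W.Δ).toNat = 2) ∧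
    (ϖ ^ 2 ∣ W.a₆ →
      (¬ ϖ ^ 3 ∣ W.b₈ → (addVal R W.Δ).toNat = 3) ∧
      (ϖ ^ 3 ∣ W.b₈ →
        (¬ ϖ ^ 3 ∣ W.b₆ → (addVal R W.Δ).toNat = 4) ∧
        (ϖ ^ 3 ∣ W.b₆ → ϖ ^ 2 ∣ W.c₄ ∧ ϖ ^ 3 ∣ W.c₆))) := by
  obtain ⟨γ, hγ⟩ := ha₃
  obtain ⟨q, hq⟩ := ha₄
  obtain ⟨r, hr⟩ := ha₆
  obtain ⟨β, hβ⟩ := hb₂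
  have hb₄ := b₄_of_a W ϖ hγ hq
  have hb₆ := b₆_of_a W ϖ hγ hr
  have h4 : IsUnit (4 : R) := isUnit_four h2
  have h32 : IsUnit (32 : R) := isUnit_32 h2
  have h108 : IsUnit (108 : R) := isUnit_108 h2 h3
  have hϖ0 : ϖ ≠ 0 := hϖ.ne_zero
  constructor
  · intro h6
    have hru : IsUnit r := by
      rw [isUnit_iff_not_dvd hϖ]
      intro h; apply h6; rw [hr, pow_two]; exact mul_dvd_mul_left ϖ h
    refine addVal_toNat_eq_of_eq_add hϖ h4 ?_ (four_Δ_step3 W ϖ hβ hb₄ hb₆)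
    exact h108.neg.mul ((isUnit_add_mul_of_isUnit hϖ (h4.mul hru) _).pow 2)
  · intro h6
    have hr' : ϖ ∣ r := by
      rw [hr, pow_two] at h6; exact (mul_dvd_mul_iff_left hϖ0).mp h6
    obtain ⟨r', hr''⟩ := hr'
    have hb₆' : W.b₆ = ϖ ^ 2 * (4 * r' + γ ^ 2) := by rw [hb₆, hr'']; ring
    have hb₈ := four_b₈_step4 W ϖ hβ hb₄ hb₆'
    constructor
    · intro h8
      have hB₄ : IsUnit (2 * q + W.a₁ * γ) := by
        rw [isUnit_iff_not_dvd hϖ]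
        intro hd
        apply h8
        rw [← h4.dvd_mul_left, hb₈, pow_succ]
        refine mul_dvd_mul_left _ (dvd_sub ⟨β * (4 * r' + γ ^ 2), by ring⟩ ?_)
        rw [pow_two]; exact dvd_mul_of_dvd_left hd _
      exact addVal_toNat_eq_of_eq_add hϖ h4 (h32.neg.mul (hB₄.pow 3))
        (four_Δ_step4 W ϖ hβ hb₄ hb₆')
    · intro h8
      have hB₄ : ϖ ∣ 2 * q + W.a₁ * γ := by
        have h8' : ϖ ^ 3 ∣ 4 * W.b₈ := dvd_mul_of_dvd_right h8 4
        rw [hb₈, pow_succ, mul_dvd_mul_iff_left (pow_ne_zero 2 hϖ0)] at h8'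
        have h' : ϖ ∣ (2 * q + W.a₁ * γ) ^ 2 := by
          have := dvd_sub (⟨β * (4 * r' + γ ^ 2), by ring⟩ : ϖ ∣ ϖ * β * (4 * r' + γ ^ 2)) h8'
          rwa [sub_sub_cancel] at this
        exact hϖ.prime.dvd_of_dvd_pow h'
      obtain ⟨B₄, hB₄'⟩ := hB₄
      have hb₄' : W.b₄ = ϖ ^ 2 * B₄ := by rw [hb₄, hB₄']; ring
      constructor
      · intro h6'
        have hB₆ : IsUnit (4 * r' + γ ^ 2) := by
          rw [isUnit_iff_not_dvd hϖ]
          intro hd; apply h6'; rw [hb₆', pow_succ]; exact mul_dvd_mul_left _ hd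
        exact addVal_toNat_eq_of_eq_add hϖ h4 (h108.neg.mul (hB₆.pow 2))
          (four_Δ_step5 W ϖ hβ hb₄' hb₆')
      · intro h6'
        rw [hb₆', pow_succ, mul_dvd_mul_iff_left (pow_ne_zero 2 hϖ0)] at h6'
        obtain ⟨B₆, hB₆⟩ := h6'
        have hb₆'' : W.b₆ = ϖ ^ 3 * B₆ := by rw [hb₆', hB₆]; ring
        exact ⟨⟨_, c₄_of_b W ϖ hβ hb₄'⟩, ⟨_, c₆_of_b W ϖ hβ hb₄' hb₆''⟩⟩

/-- **Steps 6–8, branching** (Silverman ATAEC IV.9.4) on a step-6 normalised model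
(`π ∣ a₁, a₂`, `π² ∣ a₃, a₄`, `π³ ∣ a₆`) in residue characteristic `≠ 2, 3`: three distinct
roots of `P` iff `ord Δ = 6` (type I₀*, Table 4.1); otherwise `π⁷ ∣ Δ`, and a double root
(step 7) forces `ord c₄ = 2` and the existence of the step-7 translation, while a triple root
(step 8) forces `π³ ∣ c₄`, `π⁴ ∣ c₆`. [cite: SilvermanATAEC1994, IV.9.4 steps 6–8 and Table 4.1] -/
theorem step6 (h2 : IsUnit (2 : R)) (h3 : IsUnit (3 : R)) (W : WeierstrassCurve R)
    (ha₁ : uniformizer R ∣ W.a₁) (ha₂ : uniformizer R ∣ W.a₂) (ha₃ : uniformizer R ^ 2 ∣ W.a₃)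
    (ha₄ : uniformizer R ^ 2 ∣ W.a₄) (ha₆ : uniformizer R ^ 3 ∣ W.a₆) :
    (distinctRootCount (cubicStep6 W) = 3 → (addVal R W.Δ).toNat = 6) ∧
    (distinctRootCount (cubicStep6 W) ≠ 3 → uniformizer R ^ 7 ∣ W.Δ ∧
      (distinctRootCount (cubicStep6 W) = 2 →
        (∃ u, IsUnit u ∧ W.c₄ = uniformizer R ^ 2 * u) ∧
        ∃ C : WeierstrassCurve.VariableChange R, C.u = 1 ∧
          (C • W).a₁ ∈ maximalIdeal R ∧ (C • W).a₂ ∈ maximalIdeal R ∧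
          (C • W).a₃ ∈ maximalIdeal R ^ 2 ∧ (C • W).a₄ ∈ maximalIdeal R ^ 3 ∧
          (C • W).a₆ ∈ maximalIdeal R ^ 4) ∧
      (distinctRootCount (cubicStep6 W) ≠ 2 →
        uniformizer R ^ 3 ∣ W.c₄ ∧ uniformizer R ^ 4 ∣ W.c₆)) := by
  set ϖ := uniformizer R with hϖdef
  have hϖ : Irreducible ϖ := irreducible_uniformizer
  obtain ⟨α, hα⟩ := ha₁
  obtain ⟨p, hp⟩ := ha₂
  obtain ⟨γ, hγ⟩ := ha₃
  obtain ⟨q, hq⟩ := ha₄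
  obtain ⟨r, hr⟩ := ha₆
  have h4 : IsUnit (4 : R) := isUnit_four h2
  have hk2 := residue_two_ne_zero h2
  have hk3 := residue_three_ne_zero h3
  have hres0 : residue R ϖ = 0 := residue_uniformizer_eq_zero hϖ
  have hP : cubicStep6 W = X ^ 3 + C (residue R p) * X ^ 2 + C (residue R q) * X +
      C (residue R r) := by
    simp only [cubicStep6, hp, hq, hr, hϖdef, redCoeff_uniformizer_mul,
      redCoeff_uniformizer_pow_mul]
  set B₂ : R := 4 * p + ϖ * α ^ 2 with hB₂
  set B₄ : R := 2 * q + ϖ * α * γ with hB₄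
  set B₆ : R := 4 * r + ϖ * γ ^ 2 with hB₆
  have hb₂ : W.b₂ = ϖ * B₂ := b₂_step6 W ϖ hα hp
  have hb₄ : W.b₄ = ϖ ^ 2 * B₄ := b₄_step6 W ϖ hα hγ hq
  have hb₆ : W.b₆ = ϖ ^ 3 * B₆ := b₆_step6 W ϖ hγ hr
  have hΔ := four_Δ_step6 W ϖ hb₂ hb₄ hb₆
  set D : R := -B₂ ^ 2 * (B₂ * B₆ - B₄ ^ 2) - 32 * B₄ ^ 3 - 108 * B₆ ^ 2 + 36 * B₂ * B₄ * B₆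
    with hD
  set p' := residue R p
  set q' := residue R q
  set r' := residue R r
  have hDres : residue R D = 64 * (p' ^ 2 * q' ^ 2 - 4 * q' ^ 3 - 4 * p' ^ 3 * r' -
      27 * r' ^ 2 + 18 * p' * q' * r') := by
    simp only [hD, hB₂, hB₄, hB₆, map_add, map_sub, map_mul, map_neg, map_pow, map_ofNat, hres0]
    ring
  have h64 : (64 : ResidueField R) ≠ 0 := by
    have : (64 : ResidueField R) = 2 ^ 6 := by norm_num
    rw [this]; exact pow_ne_zero _ hk2
  have hc₄ : W.c₄ = ϖ ^ 2 * (B₂ ^ 2 - 24 * B₄) := c₄_of_b W ϖ hb₂ hb₄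
  have hc₄res : residue R (B₂ ^ 2 - 24 * B₄) = 16 * (p' ^ 2 - 3 * q') := by
    simp only [hB₂, hB₄, map_add, map_sub, map_mul, map_pow, map_ofNat, hres0]
    ring
  have h16 : (16 : ResidueField R) ≠ 0 := by
    have : (16 : ResidueField R) = 2 ^ 4 := by norm_num
    rw [this]; exact pow_ne_zero _ hk2
  constructor
  · intro h3r
    rw [hP, distinctRootCount_cubic_eq_three_iff] at h3r
    have hDu : IsUnit D := by
      rw [isUnit_iff_residue_ne_zero, hDres]; exact mul_ne_zero h64 h3r
    exact addVal_toNat_eq_of_eq hϖ h4 hDu hΔ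
  · intro h3r
    rw [hP, Ne, distinctRootCount_cubic_eq_three_iff, not_not] at h3r
    have hDd : ϖ ∣ D := by
      rw [dvd_iff_residue_eq_zero hϖ, hDres, h3r, mul_zero]
    have hΔ7 : ϖ ^ 7 ∣ W.Δ := by
      rw [← h4.dvd_mul_left, hΔ, pow_succ]; exact mul_dvd_mul_left _ hDd
    refine ⟨hΔ7, ?_, ?_⟩
    · intro h2r
      rw [hP, distinctRootCount_cubic_eq_two_iff _ _ _ h3r] at h2r
      refine ⟨⟨B₂ ^ 2 - 24 * B₄, ?_, hc₄⟩, ?_⟩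
      · rw [isUnit_iff_residue_ne_zero, hc₄res]; exact mul_ne_zero h16 h2r
      · obtain ⟨a, ha, ha'⟩ := exists_double_root_of_cubicDiscr_eq_zero hk2 p' q' r' h3r h2r
        obtain ⟨ρ, hρ⟩ := residue_surjective a
        refine exists_variableChange_istarInit hϖ W (ρ := ρ) hα hp hγ hq hr ?_ ?_
        · rw [dvd_iff_residue_eq_zero hϖ]
          simp only [map_add, map_mul, map_pow, hρ]; exact ha
        · rw [dvd_iff_residue_eq_zero hϖ]
          simp only [map_add, map_mul, map_pow, map_ofNat, hρ]; exact ha'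
    · intro h2r
      rw [hP, Ne, distinctRootCount_cubic_eq_two_iff _ _ _ h3r, not_not] at h2r
      have hc₄3 : ϖ ^ 3 ∣ W.c₄ := by
        rw [hc₄, pow_succ]
        refine mul_dvd_mul_left _ ?_
        rw [dvd_iff_residue_eq_zero hϖ, hc₄res, h2r, mul_zero]
      refine ⟨hc₄3, ?_⟩
      have h7 : ϖ ^ (2 * 3 + 1) ∣ W.c₆ ^ 2 := by
        have : W.c₆ ^ 2 = W.c₄ ^ 3 - 1728 * W.Δ := by linear_combination W.c_relation
        rw [this]
        have h9 : ϖ ^ (2 * 3 + 1) ∣ (ϖ ^ 3) ^ 3 := Dvd.intro (ϖ ^ 2) (by ring)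
        refine dvd_sub (h9.trans (pow_dvd_pow_of_dvd hc₄3 3)) ?_
        exact dvd_mul_of_dvd_right hΔ7 _
      exact pow_succ_dvd_of_pow_dvd_sq hϖ h7

/-- **Step 8** (Silverman ATAEC IV.9.4) on a step-8 normalised model (`π ∣ a₁`, `π² ∣ a₂, a₃`,
`π³ ∣ a₄`, `π⁴ ∣ a₆`) in residue characteristic `≠ 2, 3`: the quadratic `Y² + a₃,₂ Y − a₆,₄` has
distinct roots iff `ord Δ = 8` (type IV*, Table 4.1); otherwise `π³ ∣ c₄` and `π⁵ ∣ c₆`.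
[cite: SilvermanATAEC1994, IV.9.4 step 8 and Table 4.1] -/
theorem step8 (h2 : IsUnit (2 : R)) (h3 : IsUnit (3 : R)) (W : WeierstrassCurve R)
    (ha₁ : uniformizer R ∣ W.a₁) (ha₂ : uniformizer R ^ 2 ∣ W.a₂)
    (ha₃ : uniformizer R ^ 2 ∣ W.a₃) (ha₄ : uniformizer R ^ 3 ∣ W.a₄)
    (ha₆ : uniformizer R ^ 4 ∣ W.a₆) :
    (distinctRootCount (quadraticStep8 W) = 2 → (addVal R W.Δ).toNat = 8) ∧
    (distinctRootCount (quadraticStep8 W) ≠ 2 →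
      uniformizer R ^ 3 ∣ W.c₄ ∧ uniformizer R ^ 5 ∣ W.c₆) := by
  set ϖ := uniformizer R with hϖdef
  have hϖ : Irreducible ϖ := irreducible_uniformizer
  obtain ⟨α, hα⟩ := ha₁
  obtain ⟨p, hp⟩ := ha₂
  obtain ⟨γ, hγ⟩ := ha₃
  obtain ⟨q, hq⟩ := ha₄
  obtain ⟨r, hr⟩ := ha₆
  have h4 : IsUnit (4 : R) := isUnit_four h2
  have h108 : IsUnit (108 : R) := isUnit_108 h2 h3
  have hQ : quadraticStep8 W = X ^ 2 + C (residue R γ) * X - C (residue R r) := by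
    simp only [quadraticStep8, hγ, hr, hϖdef, redCoeff_uniformizer_pow_mul]
  have hb₂ := b₂_step8 W ϖ hα hp
  have hb₄ := b₄_step8 W ϖ hα hγ hq
  have hb₆ := b₆_step8 W ϖ hγ hr
  have htest : distinctRootCount (quadraticStep8 W) = 2 ↔ IsUnit (γ ^ 2 + 4 * r) := by
    rw [hQ, distinctRootCount_monicQuadratic_eq_two_iff h2, isUnit_iff_residue_ne_zero,
      map_add, map_mul, map_pow, map_ofNat]
  constructor
  · intro ht
    rw [htest] at ht
    exact addVal_toNat_eq_of_eq_add hϖ h4 (h108.neg.mul (ht.pow 2)) (four_Δ_step8 W ϖ hb₂ hb₄ hb₆)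
  · intro ht
    rw [Ne, htest, not_isUnit_iff_dvd hϖ] at ht
    obtain ⟨B₆, hB₆⟩ := ht
    have hb₆' : W.b₆ = ϖ ^ 5 * B₆ := by rw [hb₆, hB₆]; ring
    exact ⟨⟨_, c₄_step8 W ϖ hb₂ hb₄⟩, ⟨_, c₆_step8 W ϖ hb₂ hb₄ hb₆'⟩⟩

/-- **Steps 9–10** (Silverman ATAEC IV.9.4) on a step-9 normalised model (`π ∣ a₁`, `π² ∣ a₂`,
`π³ ∣ a₃, a₄`, `π⁵ ∣ a₆`) in residue characteristic `≠ 2, 3`: `π⁴ ∤ a₄` iff `ord Δ = 9`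
(type III*), else `π⁶ ∤ a₆` iff `ord Δ = 10` (type II*) (Table 4.1).
[cite: SilvermanATAEC1994, IV.9.4 steps 9–10 and Table 4.1] -/
theorem steps910 {ϖ : R} (hϖ : Irreducible ϖ) (h2 : IsUnit (2 : R)) (h3 : IsUnit (3 : R))
    (W : WeierstrassCurve R) (ha₁ : ϖ ∣ W.a₁) (ha₂ : ϖ ^ 2 ∣ W.a₂) (ha₃ : ϖ ^ 3 ∣ W.a₃)
    (ha₄ : ϖ ^ 3 ∣ W.a₄) (ha₆ : ϖ ^ 5 ∣ W.a₆) :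
    (¬ ϖ ^ 4 ∣ W.a₄ → (addVal R W.Δ).toNat = 9) ∧
    (ϖ ^ 4 ∣ W.a₄ → ¬ ϖ ^ 6 ∣ W.a₆ → (addVal R W.Δ).toNat = 10) := by
  obtain ⟨α, hα⟩ := ha₁
  obtain ⟨p, hp⟩ := ha₂
  obtain ⟨γ, hγ⟩ := ha₃
  obtain ⟨q, hq⟩ := ha₄
  obtain ⟨r, hr⟩ := ha₆
  have h4 : IsUnit (4 : R) := isUnit_four h2
  have h32 : IsUnit (32 : R) := isUnit_32 h2
  have h108 : IsUnit (108 : R) := isUnit_108 h2 h3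
  have hϖ0 : ϖ ≠ 0 := hϖ.ne_zero
  have hb₂ := b₂_step8 W ϖ hα hp
  have hb₆ := b₆_step9 W ϖ hγ hr
  constructor
  · intro h9
    have hqu : IsUnit q := by
      rw [isUnit_iff_not_dvd hϖ]
      intro hd; apply h9; rw [hq, pow_succ]; exact mul_dvd_mul_left _ hd
    have hB₄ : IsUnit (2 * q + ϖ * α * γ) := by
      have := isUnit_add_mul_of_isUnit hϖ (h2.mul hqu) (α * γ)
      rwa [← mul_assoc] at this
    exact addVal_toNat_eq_of_eq_add hϖ h4 (h32.neg.mul (hB₄.pow 3))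
      (four_Δ_step9 W ϖ hb₂ (b₄_step9 W ϖ hα hγ hq) hb₆)
  · intro h9 h10
    rw [hq, pow_succ, mul_dvd_mul_iff_left (pow_ne_zero 3 hϖ0)] at h9
    obtain ⟨q', hq'⟩ := h9
    have hq'' : W.a₄ = ϖ ^ 4 * q' := by rw [hq, hq']; ring
    have hru : IsUnit r := by
      rw [isUnit_iff_not_dvd hϖ]
      intro hd; apply h10; rw [hr, pow_succ]; exact mul_dvd_mul_left _ hd
    have hB₆ : IsUnit (4 * r + ϖ * γ ^ 2) := isUnit_add_mul_of_isUnit hϖ (h4.mul hru) _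
    exact addVal_toNat_eq_of_eq_add hϖ h4 (h108.neg.mul (hB₆.pow 2))
      (four_Δ_step10 W ϖ hb₂ (b₄_step10 W ϖ hα hγ hq'') hb₆)

end Phases

/-! ### Step 7: the `Iₙ*` subprocedure -/

section Istar

variable {R : Type*} [CommRing R] [IsDomain R] [IsDiscreteValuationRing R]

/-- In the `Iₙ*` rounds, `ord c₄ = 2` forces `π ∥ a₂`: with `b₂ = ϖ B₂`, `b₄ = ϖ^{m+3} B₄` and
`c₄ = ϖ² u`, `B₂` is a unit. [folklore] -/
theorem isUnit_B₂_istar {ϖ : R} (hϖ : Irreducible ϖ) (W : WeierstrassCurve R) {m : ℕ}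
    {B₂ B₄ u : R} (hb₂ : W.b₂ = ϖ * B₂) (hb₄ : W.b₄ = ϖ ^ (m + 3) * B₄) (hu : IsUnit u)
    (hc₄ : W.c₄ = ϖ ^ 2 * u) : IsUnit B₂ := by
  have h := c₄_istar W ϖ hb₂ hb₄
  rw [hc₄] at h
  have h' := mul_left_cancel₀ (pow_ne_zero 2 hϖ.ne_zero) h
  have : IsUnit (B₂ ^ 2) := by
    have e : B₂ ^ 2 = u + ϖ * (24 * ϖ ^ m * B₄) := by rw [h']; ring
    rw [e]; exact isUnit_add_mul_of_isUnit hϖ hu _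
  exact (isUnit_pow_iff two_ne_zero).mp this

/-- One-step unfolding of `istarIndexAux` (its auto-generated equation lemmas are too
expensive to realise, so we unfold the structural recursion by `delta` + `rfl`). [folklore] -/
theorem istarIndexAux_succ (fuel m : ℕ) (W : WeierstrassCurve R) :
    istarIndexAux (fuel + 1) m W =
    (open scoped Classical in
    if distinctRootCount
        (X ^ 2 + C (redCoeff W.a₃ (m + 2)) * X - C (redCoeff W.a₆ (2 * m + 4))) = 2 then
      2 * m + 1
    else
      let W' : WeierstrassCurve R :=
        if h : ∃ C : WeierstrassCurve.VariableChange R, C.u = 1 ∧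
            (C • W).a₁ ∈ maximalIdeal R ∧ (C • W).a₂ ∈ maximalIdeal R ∧
            (C • W).a₃ ∈ maximalIdeal R ^ (m + 3) ∧
            (C • W).a₄ ∈ maximalIdeal R ^ (m + 3) ∧
            (C • W).a₆ ∈ maximalIdeal R ^ (2 * m + 5)
          then h.choose • W else W
      if distinctRootCount (C (redCoeff W'.a₂ 1) * X ^ 2 + C (redCoeff W'.a₄ (m + 3)) * X +
          C (redCoeff W'.a₆ (2 * m + 5))) = 2 then
        2 * m + 2
      else
        let W'' : WeierstrassCurve R :=
          if h : ∃ C : WeierstrassCurve.VariableChange R, C.u = 1 ∧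
              (C • W').a₁ ∈ maximalIdeal R ∧ (C • W').a₂ ∈ maximalIdeal R ∧
              (C • W').a₃ ∈ maximalIdeal R ^ (m + 3) ∧
              (C • W').a₄ ∈ maximalIdeal R ^ (m + 4) ∧
              (C • W').a₆ ∈ maximalIdeal R ^ (2 * m + 6)
            then h.choose • W' else W'
        istarIndexAux fuel (m + 1) W'') := by
  delta istarIndexAux
  rfl

/-- **Step 7, subprocedure** (Silverman ATAEC IV.9.4): on a model normalised for round `m`
(`π ∣ a₁, a₂`, `π^{m+2} ∣ a₃`, `π^{m+3} ∣ a₄`, `π^{2m+4} ∣ a₆`, `ord c₄ = 2`) and with enough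
fuel, `istarIndexAux` returns `n = ord Δ − 6` in residue characteristic `≠ 2, 3` ("if `p ≠ 2`
then `n = v(Δ) − 6`"). [cite: SilvermanATAEC1994, IV.9.4 step 7] -/
theorem istarIndexAux_add_six (h2 : IsUnit (2 : R)) :
    ∀ (fuel m : ℕ) (W : WeierstrassCurve R), W.Δ ≠ 0 →
      uniformizer R ∣ W.a₁ → uniformizer R ∣ W.a₂ → uniformizer R ^ (m + 2) ∣ W.a₃ →
      uniformizer R ^ (m + 3) ∣ W.a₄ → uniformizer R ^ (2 * m + 4) ∣ W.a₆ →
      (∃ u, IsUnit u ∧ W.c₄ = uniformizer R ^ 2 * u) →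
      (addVal R W.Δ).toNat < 2 * m + 7 + fuel →
      istarIndexAux fuel m W + 6 = (addVal R W.Δ).toNat := by
  classical
  have hϖ : Irreducible (uniformizer R) := irreducible_uniformizer
  have h4 : IsUnit (4 : R) := isUnit_four h2
  have hk2 := residue_two_ne_zero h2
  have hres0 : residue R (uniformizer R) = 0 := residue_uniformizer_eq_zero hϖ
  intro fuel
  induction fuel with
  | zero =>
    intro m W hΔ0 ha₁ ha₂ ha₃ ha₄ ha₆ _ hlt
    exfalso
    obtain ⟨α, hα⟩ := ha₁
    obtain ⟨p, hp⟩ := ha₂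
    obtain ⟨γ, hγ⟩ := ha₃
    obtain ⟨q, hq⟩ := ha₄
    obtain ⟨r, hr⟩ := ha₆
    have hΔ := four_Δ_istar1 W _ (b₂_step6 W _ hα hp) (b₄_istar1 W _ hα hγ hq)
      (b₆_istar1 W _ hγ hr)
    have hdvd : uniformizer R ^ (2 * m + 7) ∣ W.Δ := by
      rw [← h4.dvd_mul_left, hΔ]; exact dvd_mul_right _ _
    have := le_addVal_toNat_of_pow_dvd hϖ hΔ0 hdvd
    omega
  | succ n ih =>
    intro m W hΔ0 ha₁ ha₂ ha₃ ha₄ ha₆ hc₄ hlt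
    obtain ⟨α, hα⟩ := ha₁
    obtain ⟨p, hp⟩ := ha₂
    obtain ⟨γ, hγ⟩ := ha₃
    obtain ⟨q, hq⟩ := ha₄
    obtain ⟨r, hr⟩ := ha₆
    obtain ⟨u, hu, hc₄u⟩ := hc₄
    have hb₂ := b₂_step6 W _ hα hp
    have hb₄ := b₄_istar1 W _ hα hγ hq
    have hb₆ := b₆_istar1 W _ hγ hr
    have hB₂u : IsUnit (4 * p + uniformizer R * α ^ 2) := isUnit_B₂_istar hϖ W hb₂ hb₄ hu hc₄u
    -- first test
    have hQ1 : X ^ 2 + C (redCoeff W.a₃ (m + 2)) * X - C (redCoeff W.a₆ (2 * m + 4)) =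
        X ^ 2 + C (residue R γ) * X - C (residue R r) := by
      simp only [hγ, hr, redCoeff_uniformizer_pow_mul]
    have htest1 : distinctRootCount
        (X ^ 2 + C (redCoeff W.a₃ (m + 2)) * X - C (redCoeff W.a₆ (2 * m + 4))) = 2 ↔
        IsUnit (γ ^ 2 + 4 * r) := by
      rw [hQ1, distinctRootCount_monicQuadratic_eq_two_iff h2, isUnit_iff_residue_ne_zero,
        map_add, map_mul, map_pow, map_ofNat]
    rw [istarIndexAux_succ]
    dsimp only
    by_cases ht1 : IsUnit (γ ^ 2 + 4 * r)
    · rw [if_pos (htest1.mpr ht1)]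
      have := addVal_toNat_eq_of_eq_add hϖ h4 ((hB₂u.pow 3).neg.mul ht1)
        (four_Δ_istar1 W _ hb₂ hb₄ hb₆)
      omega
    rw [if_neg (mt htest1.mp ht1)]
    have hd1 : uniformizer R ∣ γ ^ 2 + 4 * r := (not_isUnit_iff_dvd hϖ _).mp ht1
    have hexA := exists_variableChange_istarA hϖ h2 W hα hp hγ hq hr hd1
    rw [dif_pos hexA]
    obtain ⟨hu1, hA₁, hA₂, hA₃, hA₄, hA₆⟩ := hexA.choose_spec
    set W1 := hexA.choose • W with hW1
    have hΔ1 : W1.Δ = W.Δ := Δ_smul_of_u_eq_one hu1 W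
    have hc₄1 : W1.c₄ = W.c₄ := c₄_smul_of_u_eq_one hu1 W
    obtain ⟨α1, hα1⟩ := (mem_maximalIdeal_iff_dvd_of_irreducible hϖ _).mp hA₁
    obtain ⟨p1, hp1⟩ := (mem_maximalIdeal_iff_dvd_of_irreducible hϖ _).mp hA₂
    obtain ⟨γ1, hγ1⟩ := (mem_maximalIdeal_pow_iff_dvd_of_irreducible hϖ _ _).mp hA₃
    obtain ⟨q1, hq1⟩ := (mem_maximalIdeal_pow_iff_dvd_of_irreducible hϖ _ _).mp hA₄
    obtain ⟨r1, hr1⟩ := (mem_maximalIdeal_pow_iff_dvd_of_irreducible hϖ _ _).mp hA₆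
    have hb₂1 := b₂_step6 W1 _ hα1 hp1
    have hb₄1 := b₄_istar2 W1 _ hα1 hγ1 hq1
    have hb₆1 := b₆_istar2 W1 _ hγ1 hr1
    have hB₂1u : IsUnit (4 * p1 + uniformizer R * α1 ^ 2) :=
      isUnit_B₂_istar hϖ W1 hb₂1 hb₄1 hu (hc₄1.trans hc₄u)
    have hp1u : residue R p1 ≠ 0 := by
      have := (isUnit_iff_residue_ne_zero _).mp hB₂1u
      rw [map_add, map_mul, map_mul, map_pow, map_ofNat, hres0, zero_mul, add_zero] at this
      exact (mul_ne_zero_iff.mp this).2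
    -- second test
    have hQ2 : C (redCoeff W1.a₂ 1) * X ^ 2 + C (redCoeff W1.a₄ (m + 3)) * X +
        C (redCoeff W1.a₆ (2 * m + 5)) =
        C (residue R p1) * X ^ 2 + C (residue R q1) * X + C (residue R r1) := by
      simp only [hp1, hq1, hr1, redCoeff_uniformizer_mul, redCoeff_uniformizer_pow_mul]
    set B₂1 : R := 4 * p1 + uniformizer R * α1 ^ 2 with hB₂1
    set B₄1 : R := 2 * q1 + uniformizer R * α1 * γ1 with hB₄1
    set B₆1 : R := 4 * r1 + uniformizer R * γ1 ^ 2 with hB₆1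
    have hres2 : residue R (B₂1 * B₆1 - B₄1 ^ 2) =
        -4 * (residue R q1 ^ 2 - 4 * residue R p1 * residue R r1) := by
      simp only [hB₂1, hB₄1, hB₆1, map_add, map_sub, map_mul, map_pow, map_ofNat, hres0]
      ring
    have hm4 : (-4 : ResidueField R) ≠ 0 := by
      rw [neg_ne_zero, show (4 : ResidueField R) = 2 ^ 2 by norm_num]
      exact pow_ne_zero _ hk2
    have htest2 : distinctRootCount (C (redCoeff W1.a₂ 1) * X ^ 2 +
        C (redCoeff W1.a₄ (m + 3)) * X + C (redCoeff W1.a₆ (2 * m + 5))) = 2 ↔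
        IsUnit (B₂1 * B₆1 - B₄1 ^ 2) := by
      rw [hQ2, distinctRootCount_quadratic_eq_two_iff h2 hp1u, isUnit_iff_residue_ne_zero,
        hres2, mul_ne_zero_iff, and_iff_right hm4]
    by_cases ht2 : IsUnit (B₂1 * B₆1 - B₄1 ^ 2)
    · rw [if_pos (htest2.mpr ht2)]
      have := addVal_toNat_eq_of_eq_add hϖ h4 ((hB₂1u.pow 2).neg.mul ht2)
        (four_Δ_istar2 W1 _ hb₂1 hb₄1 hb₆1)
      rw [hΔ1] at this
      omega
    rw [if_neg (mt htest2.mp ht2)]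
    have hd2 : uniformizer R ∣ q1 ^ 2 - 4 * p1 * r1 := by
      rw [dvd_iff_residue_eq_zero hϖ]
      have := (dvd_iff_residue_eq_zero hϖ _).mp ((not_isUnit_iff_dvd hϖ _).mp ht2)
      rw [hres2, mul_eq_zero, or_iff_right hm4] at this
      simpa only [map_sub, map_mul, map_pow, map_ofNat] using this
    have hexB := exists_variableChange_istarB hϖ h2 W1
      ((isUnit_iff_residue_ne_zero _).mpr hp1u) hα1 hp1 hγ1 hq1 hr1 hd2
    rw [dif_pos hexB]
    obtain ⟨hu2, hB₁, hB₂, hB₃, hB₄, hB₆⟩ := hexB.choose_spec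
    set W2 := hexB.choose • W1 with hW2
    have hΔ2 : W2.Δ = W.Δ := (Δ_smul_of_u_eq_one hu2 W1).trans hΔ1
    have hc₄2 : W2.c₄ = W.c₄ := (c₄_smul_of_u_eq_one hu2 W1).trans hc₄1
    have key := ih (m + 1) W2 (by rwa [hΔ2])
      ((mem_maximalIdeal_iff_dvd_of_irreducible hϖ _).mp hB₁) ((mem_maximalIdeal_iff_dvd_of_irreducible hϖ _).mp hB₂)
      ((mem_maximalIdeal_pow_iff_dvd_of_irreducible hϖ _ _).mp hB₃)
      ((mem_maximalIdeal_pow_iff_dvd_of_irreducible hϖ _ _).mp hB₄)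
      (by rw [show 2 * (m + 1) + 4 = 2 * m + 6 by ring]
          exact (mem_maximalIdeal_pow_iff_dvd_of_irreducible hϖ _ _).mp hB₆)
      ⟨u, hu, hc₄2.trans hc₄u⟩ (by rw [hΔ2]; omega)
    rw [hΔ2] at key
    exact key

/-- **Step 7** (Silverman ATAEC IV.9.4): for a step-6 normalised model with a double root of `P`
(`ord c₄ = 2`, `π⁷ ∣ Δ`, and the initial translation exists), `istarIndex W = ord Δ − 6`, i.e.
type `Iₙ*` with `n = v(Δ) − 6` in residue characteristic `≠ 2, 3`.
[cite: SilvermanATAEC1994, IV.9.4 step 7] -/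
theorem istarIndex_add_six (h2 : IsUnit (2 : R)) (W : WeierstrassCurve R)
    (hΔ0 : W.Δ ≠ 0) (hΔ7 : uniformizer R ^ 7 ∣ W.Δ)
    (hc₄ : ∃ u, IsUnit u ∧ W.c₄ = uniformizer R ^ 2 * u)
    (hex : ∃ C : WeierstrassCurve.VariableChange R, C.u = 1 ∧
      (C • W).a₁ ∈ maximalIdeal R ∧ (C • W).a₂ ∈ maximalIdeal R ∧
      (C • W).a₃ ∈ maximalIdeal R ^ 2 ∧ (C • W).a₄ ∈ maximalIdeal R ^ 3 ∧
      (C • W).a₆ ∈ maximalIdeal R ^ 4) :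
    istarIndex W + 6 = (addVal R W.Δ).toNat := by
  classical
  have hϖ : Irreducible (uniformizer R) := irreducible_uniformizer
  unfold istarIndex
  dsimp only
  rw [dif_pos hex]
  obtain ⟨hu, h₁, h₂, h₃, h₄, h₆⟩ := hex.choose_spec
  have hΔ' : (hex.choose • W).Δ = W.Δ := Δ_smul_of_u_eq_one hu W
  have h7 := le_addVal_toNat_of_pow_dvd hϖ hΔ0 hΔ7
  obtain ⟨u, huu, hc₄'⟩ := hc₄
  have key := istarIndexAux_add_six h2 (addVal R W.Δ).toNat 0 (hex.choose • W)
    (by rwa [hΔ']) ((mem_maximalIdeal_iff_dvd_of_irreducible hϖ _).mp h₁) ((mem_maximalIdeal_iff_dvd_of_irreducible hϖ _).mp h₂)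
    (by simpa using (mem_maximalIdeal_pow_iff_dvd_of_irreducible hϖ _ _).mp h₃)
    (by simpa using (mem_maximalIdeal_pow_iff_dvd_of_irreducible hϖ _ _).mp h₄)
    (by simpa using (mem_maximalIdeal_pow_iff_dvd_of_irreducible hϖ _ _).mp h₆)
    ⟨u, huu, (c₄_smul_of_u_eq_one hu W).trans hc₄'⟩ (by rw [hΔ']; omega)
  rwa [hΔ'] at key

end Istar

/-! ### The main local theorem -/

section Main

variable {R : Type*} [CommRing R] [IsDomain R] [IsDiscreteValuationRing R]

/-- **Tate's algorithm in residue characteristic `≠ 2, 3`: `ord Δ = m + 1` for additive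
reduction.** Let `R` be a DVR with `2, 3 ∈ Rˣ` and `W` a Weierstrass equation over `R` with
`Δ ≠ 0`, `π ∣ Δ`, `π ∣ c₄` (additive reduction), such that no change of variables `(1, r, s, t)`
over `R` achieves `π ^ i ∣ aᵢ` for `i = 1, 2, 3, 4, 6` (true for a minimal equation). Then the
Kodaira type `T` computed by steps 1–10 of Tate's algorithm (`kodairaSymbolOfMinimal`) satisfies
`ord Δ = m(T) + 1`, i.e. `v(Δ) = 2, 3, 4, 6, 6 + n, 8, 9, 10` for
`T = II, III, IV, I₀*, Iₙ*, IV*, III*, II*` (Silverman ATAEC IV.9.4 and Table 4.1, rows `m` and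
`v(Δ)`, valid for `char k ≠ 2, 3`). [cite: SilvermanATAEC1994, IV.9.4 and Table 4.1] -/
theorem addVal_Δ_toNat_eq_numComponents_add_one (h2 : IsUnit (2 : R)) (h3 : IsUnit (3 : R))
    (W : WeierstrassCurve R) (hΔ0 : W.Δ ≠ 0) (hΔ : W.Δ ∈ maximalIdeal R)
    (hc₄ : W.c₄ ∈ maximalIdeal R)
    (hmin : ∀ C : WeierstrassCurve.VariableChange R, C.u = 1 →
      uniformizer R ∣ (C • W).a₁ → uniformizer R ^ 2 ∣ (C • W).a₂ →
      uniformizer R ^ 3 ∣ (C • W).a₃ → uniformizer R ^ 4 ∣ (C • W).a₄ →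
      uniformizer R ^ 6 ∣ (C • W).a₆ → False) :
    (addVal R W.Δ).toNat = (W.kodairaSymbolOfMinimal).numComponents + 1 := by
  classical
  have hϖ : Irreducible (uniformizer R) := irreducible_uniformizer
  have hprime := hϖ.prime
  -- invariants
  have hc₄d : uniformizer R ∣ W.c₄ := (mem_maximalIdeal_iff_dvd_of_irreducible hϖ _).mp hc₄
  have hΔd : uniformizer R ∣ W.Δ := (mem_maximalIdeal_iff_dvd_of_irreducible hϖ _).mp hΔ
  have hc₆d : uniformizer R ∣ W.c₆ := by
    have h' : uniformizer R ∣ W.c₆ ^ 2 := by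
      have e : W.c₆ ^ 2 = W.c₄ ^ 3 - 1728 * W.Δ := by linear_combination W.c_relation
      rw [e]
      exact dvd_sub (dvd_pow hc₄d three_ne_zero) (dvd_mul_of_dvd_right hΔd _)
    exact hprime.dvd_of_dvd_pow h'
  -- step 2 translation
  obtain ⟨C₂, hC₂u, h21, h22, h23, h24, h26⟩ := exists_variableChange_of_dvd_c₄_c₆ h2 h3 W
    (i := 1) (j := 1) (by simpa using hc₄d) (by simpa using hc₆d)
  have hex2 : ∃ C : WeierstrassCurve.VariableChange R, C.u = 1 ∧
      (C • W).a₃ ∈ maximalIdeal R ∧ (C • W).a₄ ∈ maximalIdeal R ∧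
      (C • W).a₆ ∈ maximalIdeal R :=
    ⟨C₂, hC₂u, by rw [h23]; exact zero_mem _,
      (mem_maximalIdeal_iff_dvd_of_irreducible hϖ _).mpr (by simpa using h24),
      (mem_maximalIdeal_iff_dvd_of_irreducible hϖ _).mpr (by simpa using h26)⟩
  have hN2 : normalizeStep2 W = hex2.choose • W := dif_pos hex2
  obtain ⟨hu₂, hA₃, hA₄, hA₆⟩ := hex2.choose_spec
  -- unfold the algorithm, step 1 does not fire
  unfold WeierstrassCurve.kodairaSymbolOfMinimal
  dsimp only
  rw [if_neg (not_not.mpr hΔ), hN2]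
  set W₂ := hex2.choose • W with hW₂def
  have hΔ₂ : W₂.Δ = W.Δ := Δ_smul_of_u_eq_one hu₂ W
  have hc₄₂ : W₂.c₄ = W.c₄ := c₄_smul_of_u_eq_one hu₂ W
  have hc₆₂ : W₂.c₆ = W.c₆ := c₆_smul_of_u_eq_one hu₂ W
  have ha₃ : uniformizer R ∣ W₂.a₃ := (mem_maximalIdeal_iff_dvd_of_irreducible hϖ _).mp hA₃
  have ha₄ : uniformizer R ∣ W₂.a₄ := (mem_maximalIdeal_iff_dvd_of_irreducible hϖ _).mp hA₄
  have ha₆ : uniformizer R ∣ W₂.a₆ := (mem_maximalIdeal_iff_dvd_of_irreducible hϖ _).mp hA₆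
  -- step 2 does not fire: b₂ ∈ 𝔪 since c₄ = b₂² - 24 b₄ ∈ 𝔪 and b₄ ∈ 𝔪
  have hb₂ : uniformizer R ∣ W₂.b₂ := by
    have hb₄ : uniformizer R ∣ W₂.b₄ := by
      simp only [WeierstrassCurve.b₄]
      exact dvd_add (dvd_mul_of_dvd_right ha₄ _) (dvd_mul_of_dvd_right ha₃ _)
    have : uniformizer R ∣ W₂.b₂ ^ 2 := by
      have e : W₂.b₂ ^ 2 = W₂.c₄ + 24 * W₂.b₄ := by
        simp only [WeierstrassCurve.c₄]; ring
      rw [e, hc₄₂]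
      exact dvd_add hc₄d (dvd_mul_of_dvd_right hb₄ _)
    exact hprime.dvd_of_dvd_pow this
  rw [if_neg (not_not.mpr ((mem_maximalIdeal_iff_dvd_of_irreducible hϖ _).mpr hb₂))]
  have hS := steps345 hϖ h2 h3 W₂ ha₃ ha₄ ha₆ hb₂
  -- step 3
  by_cases h3t : W₂.a₆ ∈ maximalIdeal R ^ 2
  swap
  · rw [if_pos h3t, ← hΔ₂]
    exact hS.1 (mt (mem_maximalIdeal_pow_iff_dvd_of_irreducible hϖ _ _).mpr h3t)
  rw [if_neg (not_not.mpr h3t)]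
  have hS4 := hS.2 ((mem_maximalIdeal_pow_iff_dvd_of_irreducible hϖ _ _).mp h3t)
  -- step 4
  by_cases h4t : W₂.b₈ ∈ maximalIdeal R ^ 3
  swap
  · rw [if_pos h4t, ← hΔ₂]
    exact hS4.1 (mt (mem_maximalIdeal_pow_iff_dvd_of_irreducible hϖ _ _).mpr h4t)
  rw [if_neg (not_not.mpr h4t)]
  have hS5 := hS4.2 ((mem_maximalIdeal_pow_iff_dvd_of_irreducible hϖ _ _).mp h4t)
  -- step 5
  by_cases h5t : W₂.b₆ ∈ maximalIdeal R ^ 3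
  swap
  · rw [if_pos h5t, ← hΔ₂]
    exact hS5.1 (mt (mem_maximalIdeal_pow_iff_dvd_of_irreducible hϖ _ _).mpr h5t)
  rw [if_neg (not_not.mpr h5t)]
  obtain ⟨hc₄2, hc₆3⟩ := hS5.2 ((mem_maximalIdeal_pow_iff_dvd_of_irreducible hϖ _ _).mp h5t)
  -- step 6 translation
  obtain ⟨C₆, hC₆u, h61, h62, h63, h64, h66⟩ :=
    exists_variableChange_of_dvd_c₄_c₆ h2 h3 W₂ hc₄2 hc₆3
  have hex6 : ∃ C : WeierstrassCurve.VariableChange R, C.u = 1 ∧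
      (C • W₂).a₁ ∈ maximalIdeal R ∧ (C • W₂).a₂ ∈ maximalIdeal R ∧
      (C • W₂).a₃ ∈ maximalIdeal R ^ 2 ∧ (C • W₂).a₄ ∈ maximalIdeal R ^ 2 ∧
      (C • W₂).a₆ ∈ maximalIdeal R ^ 3 :=
    ⟨C₆, hC₆u, by rw [h61]; exact zero_mem _, by rw [h62]; exact zero_mem _,
      by rw [h63]; exact zero_mem _,
      (mem_maximalIdeal_pow_iff_dvd_of_irreducible hϖ _ _).mpr h64, (mem_maximalIdeal_pow_iff_dvd_of_irreducible hϖ _ _).mpr h66⟩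
  have hN6 : normalizeStep6 W₂ = hex6.choose • W₂ := dif_pos hex6
  obtain ⟨hu₆, hB₁, hB₂, hB₃, hB₄, hB₆⟩ := hex6.choose_spec
  rw [hN6]
  set W₆ := hex6.choose • W₂ with hW₆def
  have hΔ₆ : W₆.Δ = W.Δ := (Δ_smul_of_u_eq_one hu₆ W₂).trans hΔ₂
  have h6a₁ := (mem_maximalIdeal_iff_dvd_of_irreducible hϖ _).mp hB₁
  have h6a₂ := (mem_maximalIdeal_iff_dvd_of_irreducible hϖ _).mp hB₂
  have h6a₃ := (mem_maximalIdeal_pow_iff_dvd_of_irreducible hϖ _ _).mp hB₃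
  have h6a₄ := (mem_maximalIdeal_pow_iff_dvd_of_irreducible hϖ _ _).mp hB₄
  have h6a₆ := (mem_maximalIdeal_pow_iff_dvd_of_irreducible hϖ _ _).mp hB₆
  have hT := step6 h2 h3 W₆ h6a₁ h6a₂ h6a₃ h6a₄ h6a₆
  -- step 6
  by_cases h6t : distinctRootCount (cubicStep6 W₆) = 3
  · rw [if_pos h6t, ← hΔ₆]
    exact hT.1 h6t
  rw [if_neg h6t]
  obtain ⟨hΔ7, hT7, hT8⟩ := hT.2 h6t
  -- step 7
  by_cases h7t : distinctRootCount (cubicStep6 W₆) = 2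
  · rw [if_pos h7t, KodairaSymbol.numComponents_Istar, ← hΔ₆]
    obtain ⟨hc₄u, hex7⟩ := hT7 h7t
    have := istarIndex_add_six h2 W₆ (by rwa [hΔ₆]) hΔ7 hc₄u hex7
    omega
  rw [if_neg h7t]
  obtain ⟨hc₄3, hc₆4⟩ := hT8 h7t
  -- step 8 translation
  obtain ⟨C₈, hC₈u, h81, h82, h83, h84, h86⟩ :=
    exists_variableChange_of_dvd_c₄_c₆ h2 h3 W₆ hc₄3 hc₆4
  have hex8 : ∃ C : WeierstrassCurve.VariableChange R, C.u = 1 ∧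
      (C • W₆).a₁ ∈ maximalIdeal R ∧ (C • W₆).a₂ ∈ maximalIdeal R ^ 2 ∧
      (C • W₆).a₃ ∈ maximalIdeal R ^ 2 ∧ (C • W₆).a₄ ∈ maximalIdeal R ^ 3 ∧
      (C • W₆).a₆ ∈ maximalIdeal R ^ 4 :=
    ⟨C₈, hC₈u, by rw [h81]; exact zero_mem _, by rw [h82]; exact zero_mem _,
      by rw [h83]; exact zero_mem _,
      (mem_maximalIdeal_pow_iff_dvd_of_irreducible hϖ _ _).mpr h84, (mem_maximalIdeal_pow_iff_dvd_of_irreducible hϖ _ _).mpr h86⟩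
  have hN8 : normalizeStep8 W₆ = hex8.choose • W₆ := dif_pos hex8
  obtain ⟨hu₈, hC₁, hC₂, hC₃, hC₄, hC₆⟩ := hex8.choose_spec
  rw [hN8]
  set W₈ := hex8.choose • W₆ with hW₈def
  have hΔ₈ : W₈.Δ = W.Δ := (Δ_smul_of_u_eq_one hu₈ W₆).trans hΔ₆
  have h8a₁ := (mem_maximalIdeal_iff_dvd_of_irreducible hϖ _).mp hC₁
  have h8a₂ := (mem_maximalIdeal_pow_iff_dvd_of_irreducible hϖ _ _).mp hC₂
  have h8a₃ := (mem_maximalIdeal_pow_iff_dvd_of_irreducible hϖ _ _).mp hC₃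
  have h8a₄ := (mem_maximalIdeal_pow_iff_dvd_of_irreducible hϖ _ _).mp hC₄
  have h8a₆ := (mem_maximalIdeal_pow_iff_dvd_of_irreducible hϖ _ _).mp hC₆
  have hU := step8 h2 h3 W₈ h8a₁ h8a₂ h8a₃ h8a₄ h8a₆
  -- step 8
  by_cases h8t : distinctRootCount (quadraticStep8 W₈) = 2
  · rw [if_pos h8t, ← hΔ₈]
    exact hU.1 h8t
  rw [if_neg h8t]
  obtain ⟨hc₄3', hc₆5⟩ := hU.2 h8t
  -- step 9 translation
  obtain ⟨C₉, hC₉u, h91, h92, h93, h94, h96⟩ :=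
    exists_variableChange_of_dvd_c₄_c₆ h2 h3 W₈ hc₄3' hc₆5
  have hex9 : ∃ C : WeierstrassCurve.VariableChange R, C.u = 1 ∧
      (C • W₈).a₁ ∈ maximalIdeal R ∧ (C • W₈).a₂ ∈ maximalIdeal R ^ 2 ∧
      (C • W₈).a₃ ∈ maximalIdeal R ^ 3 ∧ (C • W₈).a₄ ∈ maximalIdeal R ^ 3 ∧
      (C • W₈).a₆ ∈ maximalIdeal R ^ 5 :=
    ⟨C₉, hC₉u, by rw [h91]; exact zero_mem _, by rw [h92]; exact zero_mem _,
      by rw [h93]; exact zero_mem _,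
      (mem_maximalIdeal_pow_iff_dvd_of_irreducible hϖ _ _).mpr h94, (mem_maximalIdeal_pow_iff_dvd_of_irreducible hϖ _ _).mpr h96⟩
  have hN9 : normalizeStep9 W₈ = hex9.choose • W₈ := dif_pos hex9
  obtain ⟨hu₉, hD₁, hD₂, hD₃, hD₄, hD₆⟩ := hex9.choose_spec
  rw [hN9]
  set W₉ := hex9.choose • W₈ with hW₉def
  have hΔ₉ : W₉.Δ = W.Δ := (Δ_smul_of_u_eq_one hu₉ W₈).trans hΔ₈
  have h9a₁ := (mem_maximalIdeal_iff_dvd_of_irreducible hϖ _).mp hD₁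
  have h9a₂ := (mem_maximalIdeal_pow_iff_dvd_of_irreducible hϖ _ _).mp hD₂
  have h9a₃ := (mem_maximalIdeal_pow_iff_dvd_of_irreducible hϖ _ _).mp hD₃
  have h9a₄ := (mem_maximalIdeal_pow_iff_dvd_of_irreducible hϖ _ _).mp hD₄
  have h9a₆ := (mem_maximalIdeal_pow_iff_dvd_of_irreducible hϖ _ _).mp hD₆
  have hV := steps910 hϖ h2 h3 W₉ h9a₁ h9a₂ h9a₃ h9a₄ h9a₆
  -- step 9
  by_cases h9t : W₉.a₄ ∈ maximalIdeal R ^ 4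
  swap
  · rw [if_pos h9t, ← hΔ₉]
    exact hV.1 (mt (mem_maximalIdeal_pow_iff_dvd_of_irreducible hϖ _ _).mpr h9t)
  rw [if_neg (not_not.mpr h9t)]
  have h9a₄' := (mem_maximalIdeal_pow_iff_dvd_of_irreducible hϖ _ _).mp h9t
  -- step 10
  by_cases h10t : W₉.a₆ ∈ maximalIdeal R ^ 6
  swap
  · rw [if_pos h10t, ← hΔ₉]
    exact hV.2 h9a₄' (mt (mem_maximalIdeal_pow_iff_dvd_of_irreducible hϖ _ _).mpr h10t)
  -- step 11 cannot be reached: W₉ = (C₉ C₈ C₆ C₂) • W with u = 1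
  exfalso
  have h9a₆' := (mem_maximalIdeal_pow_iff_dvd_of_irreducible hϖ _ _).mp h10t
  have hW₉ : W₉ = (hex9.choose * hex8.choose * hex6.choose * hex2.choose) • W := by
    simp only [mul_smul]; rfl
  have hu : (hex9.choose * hex8.choose * hex6.choose * hex2.choose).u = 1 := by
    simp only [WeierstrassCurve.VariableChange.mul_def, hu₂, hu₆, hu₈, hu₉, mul_one]
  refine hmin _ hu ?_ ?_ ?_ ?_ ?_
  · rw [← hW₉]; exact h9a₁
  · rw [← hW₉]; exact h9a₂
  · rw [← hW₉]; exact h9a₃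
  · rw [← hW₉]; exact h9a₄'
  · rw [← hW₉]; exact h9a₆'

end Main

end TateAlgorithm

end Literature.NumberTheory.DiophantineGeometry
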